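import Literature.NumberTheory.GaloisCohomology.PoitouTateFiniteUnramifiedTransport
import Literature.NumberTheory.GaloisCohomology.PoitouTateFiniteSelmerShaDual
import Literature.NumberTheory.GaloisCohomology.PoitouTateSha
import Literature.NumberTheory.GaloisRepresentations.HomDualReadoutUnramified
import Literature.AnabelianGeometry.AbsoluteAnabelian.FundamentalExtensionRestrictionMLFBaseConj
import Literature.NumberTheory.GaloisCohomology.ShaTwoUnitsVanishing
import Literature.NumberTheory.GaloisRepresentations.HomDualShaTwoLocalGlobalReduction
import HarnessLib

/-!
# Poitou–Tate duality for finite modules, 5/7: `Ш²` local–global at the real places, the real `Ш`-dual annihilator, native `Ш²` assembly, presentation pairings, the idèle package and the reciprocity sum (re-homed proofs)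

**Poitou–Tate duality for finite Galois modules over number fields and its consequences, proved in the tree's vocabulary from the idèle
class formation (Milne, *Arithmetic Duality Theorems* I §2, §4; Tate, ICM 1962; Harari 2020 Ch. 17–18; Serre, Durham 1977 §6): the named facts
`Literature.NumberTheory.GaloisCohomology.poitouTate_sha_tateDual` (PT (ii): `Ш¹(K, M)` and `Ш¹(K, M^D)` are exact annihilators, `PoitouTateSha.lean`),
`…poitouTate_sha_zmod_mu` (its `ℤ/m` / `μ_m` instance), `…poitouTate_three_realPlaces_injective` (Milne I Thm. 4.10 (c), degree 3,
`PoitouTateRealPlacesHigherDegree.lean`), `…poitouTate_selmerStructure_duality_conj` (duality for Selmer structures with conjugation-compatible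
canonical invariants, `PoitouTateSelmerStructuresConj.lean`), `Literature.NumberTheory.GaloisRepresentations.Patrikis2019_exists_lift_projective` / `…_exists_spinLift` /
`…_exists_spinLift_of_continuous` (Tate's `H²(Γ_K, ℚ/ℤ) = 0` and Patrikis' lifting statements, `ProjectiveLifting.lean`, `TateSpinLift.lean`,
`TateSpinLiftContinuous.lean`) and `Literature.NumberTheory.GaloisCohomology.Howard2004.prop141_casselsTate_skewPairing_atLevel_printIntended` /
`…thm161_dvrKolyvaginBound_printIntended` (Howard 2004 Prop. 1.4.1 / Thm. 1.6.1 as intended, `Howard2004/`) HOLD — EXACT names `<fact>_holds`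
(files 2 and 7 of 7).**  Contents: (1, definitions file) annihilators under a perfect `ℤ/n`-valued pairing of finite abelian groups and their counting
(Milne I §0), descent of `2`-cocycles through an open normal subgroup, the trivial module `ℤ/m` versus `μ_m` (transport maps); (2) `Ш³` and
`H³(K, M) → ⊕_{v real}` injectivity via the Brauer group (`H³(Γ_K, K̄ˣ) = 0`, odd descent, Sylow fields); (3) unramified local conditions,
inertia and the unramified subgroup, local Tate pairing vanishing on unramified classes, exact orthogonality at almost all places, bidual transport,
the all-places reduction, presentation read-out and the reciprocity equality; (4) finiteness of Selmer groups, finite duality of `Ш`-duals, new places,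
`Ш²` read-out roads, weak Leopoldt; (5) the real-place corrections, native `Ш²` assembly, presentation pairings, the idèle package and the reciprocity
sum; (6) local duality at every place, the Selmer-complement reduction, unramified orthogonality at all levels, the all-places reduction, the
middle-exact dual symmetry; (7) `Ш¹`-duality `poitouTate_sha_tateDual_holds`, the `ℤ/m`–`μ_m` instance, `H²`-finite support, Tate's theorem
`H²(Γ_K, ℚ/ℤ) = 0` for every number field and the Patrikis / Howard / Selmer-structure discharges.
RE-HOMED into `Literature/` by the Hodge foundations lane (`lit-hodgefound`, seat p20, generation 40): verbatim DECLARATION-LEVEL ports (the 221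
declarations needed, in dependency order; each Part is a slice of one Summits module) of 63 modules
`Summits/BirchSwinnertonDyer/BirchSwinnertonDyer/Theorems/{SchneiderFreeAdditiveX3PoitouTate*,SchneiderFreeAdditiveX3TateH2VanishingAllNumberFields,
CumulativeHeegnerLeopoldtRedSplitControlAtThreeSha*,ThetaPartnerAtTwoSignedControlAtTwo{MuReal*,ShaTwo*,ShaThree*,GlobalHTwoFiniteSupport},
KolyvaginRoadThreePTDevissageCofinite,PoitouTateSelmerStructureDualityConjHolds,Howard{Thm161PrintIntendedOfProp141Intended,FlachSkewPairingAtLevelIntendedHolds}}.lean`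
and `Summits/BirchSwinnertonDyer/Rank1Residual/{X11b,GaloisImage}/*.lean`; the namespaces `Summit.BirchSwinnertonDyer.BirchSwinnertonDyer.Theorems[.SchneiderFreeAdditiveX3]`
and `Summit.BirchSwinnertonDyer.Rank1Residual` are re-rooted at `Literature.NumberTheory.GaloisCohomology.PoitouTateFinite` (sub-namespaces `PoitouTateReduction`,
`PoitouTateShaTwoReadout`, `PoitouTateShaAnnihilator`, `SignedEC.*`, `KolyvaginRoadThreePT`, `InputsPoitouTateSelmer`, `Howard*`, `GaloisImage.*` kept; the route-item
segment `X11b` is dropped: `…X11b.{FiniteDuality,Levels,LocBridge,H2Support,ShaBound,WeakLeopoldt}` ↦ `PoitouTateFinite.{…}`);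
four lemmas of `X11b/MaxUnramifiedRestriction.lean` already in `Literature/NumberTheory/GaloisRepresentations/UnramifiedClassesInertia.lean` are used from
there; the nine `_holds` theorems carry the EXACT names.  Built on the tree's Literature layer (`Literature/NumberTheory/{GaloisRepresentations,GaloisCohomology,
Automorphic,EllipticCurves}/…`, `Literature/Algebra/Homology/…`, `Literature/AnabelianGeometry/AbsoluteAnabelian/…`).  No new named fact (D-0026); imports
Mathlib/Literature only; every declaration carries the citation of the printed statement it formalises or serves.  The Summits originals stay in
place (transitional duplication).  WHAT THIS IS NOT: nothing here bears on the Birch–Swinnerton-Dyer conjecture or any summit statement; it is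
classical Poitou–Tate duality for finite modules (1960s) re-proved in the tree's vocabulary.
-/

noncomputable section

/-!
## Part 1 — port of `Summits/BirchSwinnertonDyer/BirchSwinnertonDyer/Theorems/SchneiderFreeAdditiveX3PoitouTateShaTwoLocalGlobalReal.lean` (4 declarations kept)

# Poitou–Tate (ii), hypothesis (A) (local triviality) at EVERY number field: local triviality ascends at the INFINITE places, so (A3) / `tateDual_localGlobal` need no `IsTotallyComplex`

Declarations of this Part (verbatim port; each keeps its own docstring and citation): `map_tower_two_eq_zero_of_localization_inl_eq_zero`, `map_absGaloisRestrict_units_eq_zero_of_mem_shaTwo_real`, `map_evalPointHom_eq_zero_of_mem_shaTwo_real`, `tateDual_localGlobal_real`.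

Reference keys (see `references.bib` and the declarations' citations): [NeukirchSchmidtWingberg2008], [SerreLocalFields1979], [MilneADT2006].
-/

section Part1

open _root_.Function _root_.NumberField _root_.IsDedekindDomain _root_.CategoryTheory
open scoped _root_.NumberField ContRepresentation NumberField.LiesOver

namespace Literature.NumberTheory.GaloisCohomology.PoitouTateFinite.PoitouTateShaTwoReadout

open _root_.Field
open _root_.TopRep _root_.ContinuousCohomology
open Literature.NumberTheory.GaloisRepresentations Literature.NumberTheory.GaloisCohomology
open Literature.NumberTheory.GaloisRepresentations.DiscreteGaloisModule (TateDual tateDual units UnitsCarrier MuCarrier shaTwo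
  mem_shaTwo_iff mu unramifiedSubgroup localTatePairingZMod)
open Literature.NumberTheory.EllipticCurves (closureEmb resGal resGalOfEmb exists_algHom_eq_comp resGalOfEmb_comp
  resGalOfEmb_comp_tower adicCompletionMap adicCompletionMap_coe)
/-! ## §1 Local triviality ascends a finite extension (degree 2, INFINITE places) -/

section AscendInfinite

variable {K : Type} [Field K] [NumberField K]
variable {V : Type} [AddCommGroup V] [TopologicalSpace V] [DiscreteTopology V] (X : DiscreteGaloisModule K V)

/-- **Local triviality ascends `L/K` in degree 2 at an infinite place.**  For an infinite place `w` of `L` above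
`v = w.comap (K → L)`, a class `c ∈ H²(K, X)` with `loc_v c = 0` and ANY morphism of coefficients `F : X|_{Γ_{L_w}} → Y`
along the composite `Γ_{L_w} → Γ_L → Γ_K`: `H²(Γ_{L_w} → Γ_L → Γ_K, F)(c) = 0`.  The composite is conjugate (by one
`g ∈ Γ_K`, from the two `K`-embeddings `K̄ → \bar{L_w}`) to `Γ_{L_w} → Γ_{K_v} → Γ_K` (tower `K → K_v → L_w`), inner
automorphisms act trivially on `H²`, and the second route factors through `loc_v c = 0`.
[cite: SerreLocalFields1979, VII §5 Prop. 3][cite: MilneADT2006, I §4] -/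
theorem map_tower_two_eq_zero_of_localization_inl_eq_zero (L : Type) [Field L] [NumberField L] [Algebra K L]
    (w : InfinitePlace L) {W : Type} [AddCommGroup W] [TopologicalSpace W] [DiscreteTopology W]
    (Y : DiscreteGaloisModule w.Completion W)
    (F : TopRep.res (((absGaloisRestrict K L).comp (absGaloisRestrict L w.Completion) :
        absoluteGaloisGroup w.Completion →ₜ* absoluteGaloisGroup K) :
        absoluteGaloisGroup w.Completion →* absoluteGaloisGroup K) X.toTopRep ⟶ Y.toTopRep)
    (c : galoisCohomology X 2)
    (hc : galoisCohomology.localization X (Sum.inl (w.comap (algebraMap K L))) 2 c = 0) :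
    ContinuousCohomology.map ((absGaloisRestrict K L).comp (absGaloisRestrict L w.Completion)) F 2 c = 0 := by
  set v : InfinitePlace K := w.comap (algebraMap K L) with hv
  haveI := absoluteGaloisGroup_compactSpace K
  haveI := absoluteGaloisGroup_compactSpace w.Completion
  haveI := absoluteGaloisGroup_compactSpace v.Completion
  -- the tower `K → K_v → L_w` (Mathlib `NumberField.LiesOver`, scoped instances)
  haveI : w.1.LiesOver v.1 := ⟨rfl⟩
  haveI : IsScalarTower K L w.Completion := IsScalarTower.of_algebraMap_eq fun x => by
    apply NumberField.InfinitePlace.Completion.ext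
    rw [InfinitePlace.Completion.algebraMap_toCompletion, InfinitePlace.Completion.algebraMap_toCompletion,
      UniformSpace.Completion.algebraMap_def, UniformSpace.Completion.algebraMap_def,
      IsScalarTower.algebraMap_apply K L (WithAbs w.1) x]
  -- the two embeddings `K̄ → \bar{L_w}` and the conjugating element
  let ιL : AlgebraicClosure K →ₐ[K] AlgebraicClosure L := closureEmb (K := K) L
  let ι₃ : AlgebraicClosure L →ₐ[L] AlgebraicClosure w.Completion := closureEmb (K := L) w.Completion
  let ιv : AlgebraicClosure K →ₐ[K] AlgebraicClosure v.Completion := closureEmb (K := K) v.Completion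
  let ι₂ : AlgebraicClosure v.Completion →ₐ[v.Completion] AlgebraicClosure w.Completion :=
    closureEmb (K := v.Completion) w.Completion
  obtain ⟨g₀, hg⟩ := exists_algHom_eq_comp ((ι₂.restrictScalars K).comp ιv) ((ι₃.restrictScalars K).comp ιL)
  let g : absoluteGaloisGroup K := g₀
  let θA : absoluteGaloisGroup w.Completion →ₜ* absoluteGaloisGroup K :=
    (absGaloisRestrict K L).comp (absGaloisRestrict L w.Completion)
  let θB : absoluteGaloisGroup w.Completion →ₜ* absoluteGaloisGroup K :=
    (absGaloisRestrict K v.Completion).comp (absGaloisRestrict v.Completion w.Completion)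
  have key : ∀ τ, θA τ = g⁻¹ * θB τ * g := fun τ ↦ by
    change resGal (K := K) L (resGal (K := L) w.Completion τ) =
      g⁻¹ * resGal (K := K) v.Completion (resGal (K := v.Completion) w.Completion τ) * g
    have h1 : resGal (K := K) L (resGal (K := L) w.Completion τ) =
        resGalOfEmb ((ι₃.restrictScalars K).comp ιL) τ := by
      rw [resGalOfEmb_comp_tower ιL ι₃]; rfl
    have h2 : resGal (K := K) v.Completion (resGal (K := v.Completion) w.Completion τ) =
        resGalOfEmb ((ι₂.restrictScalars K).comp ιv) τ := by
      rw [resGalOfEmb_comp_tower ιv ι₂]; rfl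
    rw [h1, h2, hg, resGalOfEmb_comp]
    rfl
  -- `F ∘ g⁻¹` is equivariant along the second route
  have hcomm : ∀ (τ : absoluteGaloisGroup w.Completion) (x : V),
      F.hom (X g⁻¹ (X (θB τ) x)) = Y τ (F.hom (X g⁻¹ x)) := fun τ x ↦ by
    have hx : X g⁻¹ (X (θB τ) x) = X (θA τ) (X g⁻¹ x) := by
      rw [← Module.End.mul_apply, ← map_mul, ← Module.End.mul_apply, ← map_mul, key]
      congr 2
      group
    rw [hx]
    exact TopRep.hom_comm_apply F τ (X g⁻¹ x)
  let ginv : V →L[ℤ] V := { toLinearMap := X g⁻¹, cont := continuous_of_discreteTopology }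
  let f₂ : TopRep.res (θB : absoluteGaloisGroup w.Completion →* absoluteGaloisGroup K) X.toTopRep ⟶
      Y.toTopRep :=
    TopRep.ofHom ⟨F.hom.toContinuousLinearMap.comp ginv, fun τ => by
      refine ContinuousLinearMap.ext fun x => ?_
      change F.hom (X g⁻¹ (X (θB τ) x)) = Y τ (F.hom (X g⁻¹ x))
      exact hcomm τ x⟩
  have hinner : ContinuousCohomology.map θA F 2 c = ContinuousCohomology.map θB f₂ 2 c :=
    map_eq_map_of_inner_two g θB θA key F f₂ (fun x => by
      change F.hom x = F.hom (X g⁻¹ (X g x))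
      rw [← Module.End.mul_apply, ← map_mul, inv_mul_cancel, map_one, Module.End.one_apply]) c
  -- the second route factors through `loc_v c = 0`
  let f₂' : TopRep.res (absGaloisRestrict v.Completion w.Completion :
      absoluteGaloisGroup w.Completion →* absoluteGaloisGroup v.Completion)
        (X.restrictField v.Completion).toTopRep ⟶ Y.toTopRep :=
    TopRep.ofHom ⟨F.hom.toContinuousLinearMap.comp ginv, fun τ => by
      refine ContinuousLinearMap.ext fun x => ?_
      change F.hom (X g⁻¹ (X (θB τ) x)) = Y τ (F.hom (X g⁻¹ x))
      exact hcomm τ x⟩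
  have hc' : ContinuousCohomology.map (absGaloisRestrict K v.Completion)
      (TopRep.ofHom ⟨ContinuousLinearMap.id ℤ V, fun _ => rfl⟩ :
        TopRep.res (absGaloisRestrict K v.Completion : _ →* absoluteGaloisGroup K) X.toTopRep ⟶
          (X.restrictField v.Completion).toTopRep) 2 c = 0 := hc
  change ContinuousCohomology.map θA F 2 c = 0
  rw [hinner, map_comp_apply_of (absGaloisRestrict K v.Completion)
    (absGaloisRestrict v.Completion w.Completion) θB (fun _ => rfl)
    (TopRep.ofHom ⟨ContinuousLinearMap.id ℤ V, fun _ => rfl⟩) f₂' f₂ (fun _ => rfl) 2 c, hc']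
  exact map_zero _

end AscendInfinite

/-! ## §2 `H²(Γ_L → Γ_K, F)(c) = 0` in `H²(L, L̄ˣ)` for `c ∈ Ш²(K, X)` and ANY finite `L/K` (Brauer–Hasse–Noether) -/

section BHN

variable {K : Type} [Field K] [NumberField K]
variable {V : Type} [AddCommGroup V] [TopologicalSpace V] [DiscreteTopology V] (X : DiscreteGaloisModule K V)

/-- **A class of `Ш²(K, X)` pushed to `H²(L, L̄ˣ)` along ANY coefficient map dies** (`L/K` finite, ANY number field
`L`, real places allowed): its localisations vanish at the finite places of `L` by chl-p2's §1
(`map_tower_two_eq_zero_of_localization_eq_zero`) and at the infinite places by §1 here (`Ш²` is locally trivial at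
the infinite places too), so Brauer–Hasse–Noether (`eq_zero_of_forall_localization_units_two_eq_zero`) applies.
[cite: NeukirchSchmidtWingberg2008, (8.1.17)][cite: MilneADT2006, I §4] -/
theorem map_absGaloisRestrict_units_eq_zero_of_mem_shaTwo_real (L : Type) [Field L] [NumberField L] [Algebra K L]
    (F : TopRep.res (absGaloisRestrict K L : absoluteGaloisGroup L →* absoluteGaloisGroup K) X.toTopRep ⟶
      (units L).toTopRep)
    (c : galoisCohomology X 2) (hc : c ∈ shaTwo X) :
    ContinuousCohomology.map (absGaloisRestrict K L) F 2 c = 0 := by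
  haveI := absoluteGaloisGroup_compactSpace K
  haveI := absoluteGaloisGroup_compactSpace L
  refine eq_zero_of_forall_localization_units_two_eq_zero (K := L) _ fun p => ?_
  rcases p with w | w
  · haveI := absoluteGaloisGroup_compactSpace w.Completion
    let F' : TopRep.res (((absGaloisRestrict K L).comp (absGaloisRestrict L w.Completion) :
        absoluteGaloisGroup w.Completion →ₜ* absoluteGaloisGroup K) :
        absoluteGaloisGroup w.Completion →* absoluteGaloisGroup K) X.toTopRep ⟶
          ((units L).restrictField w.Completion).toTopRep :=
      TopRep.ofHom ⟨F.hom.toContinuousLinearMap, fun τ => by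
        refine ContinuousLinearMap.ext fun x => ?_
        change F.hom (X (absGaloisRestrict K L (absGaloisRestrict L w.Completion τ)) x) =
          units L (absGaloisRestrict L w.Completion τ) (F.hom x)
        exact TopRep.hom_comm_apply F _ x⟩
    change ContinuousCohomology.map (absGaloisRestrict L w.Completion)
      (TopRep.ofHom ⟨ContinuousLinearMap.id ℤ (UnitsCarrier L), fun _ => rfl⟩ :
        TopRep.res (absGaloisRestrict L w.Completion : _ →* absoluteGaloisGroup L) (units L).toTopRep ⟶
          ((units L).restrictField w.Completion).toTopRep) 2
      (ContinuousCohomology.map (absGaloisRestrict K L) F 2 c) = 0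
    rw [← map_comp_apply_of (absGaloisRestrict K L) (absGaloisRestrict L w.Completion)
      ((absGaloisRestrict K L).comp (absGaloisRestrict L w.Completion)) (fun _ => rfl) F
      (TopRep.ofHom ⟨ContinuousLinearMap.id ℤ (UnitsCarrier L), fun _ => rfl⟩) F' (fun _ => rfl) 2 c]
    exact map_tower_two_eq_zero_of_localization_inl_eq_zero X L w ((units L).restrictField w.Completion) F' c
      ((mem_shaTwo_iff _ c).1 hc _)
  · haveI := absoluteGaloisGroup_compactSpace (w.adicCompletion L)
    let F' : TopRep.res (((absGaloisRestrict K L).comp (absGaloisRestrict L (w.adicCompletion L)) :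
        absoluteGaloisGroup (w.adicCompletion L) →ₜ* absoluteGaloisGroup K) :
        absoluteGaloisGroup (w.adicCompletion L) →* absoluteGaloisGroup K) X.toTopRep ⟶
          ((units L).restrictField (w.adicCompletion L)).toTopRep :=
      TopRep.ofHom ⟨F.hom.toContinuousLinearMap, fun τ => by
        refine ContinuousLinearMap.ext fun x => ?_
        change F.hom (X (absGaloisRestrict K L (absGaloisRestrict L (w.adicCompletion L) τ)) x) =
          units L (absGaloisRestrict L (w.adicCompletion L) τ) (F.hom x)
        exact TopRep.hom_comm_apply F _ x⟩
    change ContinuousCohomology.map (absGaloisRestrict L (w.adicCompletion L))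
      (TopRep.ofHom ⟨ContinuousLinearMap.id ℤ (UnitsCarrier L), fun _ => rfl⟩ :
        TopRep.res (absGaloisRestrict L (w.adicCompletion L) : _ →* absoluteGaloisGroup L) (units L).toTopRep ⟶
          ((units L).restrictField (w.adicCompletion L)).toTopRep) 2
      (ContinuousCohomology.map (absGaloisRestrict K L) F 2 c) = 0
    rw [← map_comp_apply_of (absGaloisRestrict K L) (absGaloisRestrict L (w.adicCompletion L))
      ((absGaloisRestrict K L).comp (absGaloisRestrict L (w.adicCompletion L))) (fun _ => rfl) F
      (TopRep.ofHom ⟨ContinuousLinearMap.id ℤ (UnitsCarrier L), fun _ => rfl⟩) F' (fun _ => rfl) 2 c]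
    exact map_tower_two_eq_zero_of_localization_eq_zero X L w ((units L).restrictField (w.adicCompletion L)) F' c
      ((mem_shaTwo_iff _ c).1 hc _)

end BHN

/-! ## §3 (A3) at every number field: `H²(U ↪ Γ_K, ev_m)(c) = 0` for `c ∈ Ш²(K, M^D)`, `U = Gal(K̄/K(M))` -/

section Transport

variable {K : Type} [Field K] [NumberField K]
variable {M : Type} [AddCommGroup M] [TopologicalSpace M] [DiscreteTopology M] [Finite M]
variable (ρ : DiscreteGaloisModule K M) (n : ℕ) (hM : ∀ m : M, n • m = 0)

open Literature.NumberTheory.GaloisRepresentations.HomDual (evalPointHom unitsTransferAddHom unitsTransferAddHom_smul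
  unitsVal_unitsTransferAddHom apply_eq_of_mem_absGaloisFixingSubgroup_presentationLayer)
open Literature.NumberTheory.GaloisRepresentations.FreePresentation (presentationLayer)
open Literature.FieldTheory.Galois (fixingSubgroupEquivAbsoluteGaloisGroup)
open Literature.AnabelianGeometry.AbsoluteAnabelian (exists_absGaloisRestrict_fixingSubgroupEquivAbsoluteGaloisGroup_eq_conj)
open LocalWeilDatum (galFixing)

/-- **(A3) at EVERY number field — `H²(U ↪ Γ_K, ev_m)(c) = 0 ∈ H²(U, K̄ˣ)` for every `c ∈ Ш²(K, M^D)` and `m ∈ M`**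
(`U = Gal(K̄/K(M))`; NO `IsTotallyComplex`).  bsd-line-chl-p2 g7's transport argument verbatim
(`map_evalPointHom_eq_zero_of_mem_shaTwo`): along `e : U ≃ₜ* Γ_{K(M)}` (conjugate to `U ↪ Γ_K` by one `γ ∈ Γ_K`) the
comparison `H²(e⁻¹, u ↦ ι(γu)) : H²(U, K̄ˣ) → H²(K(M), \overline{K(M)}ˣ)` is injective and maps `H²(U ↪ Γ_K, ev_m)(c)` to
`H²(Γ_{K(M)} → Γ_K, ι ∘ ev_{γm})(c)`, which vanishes by §2 (real places of `K(M)` included).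
[cite: MilneADT2006, I Thm. 4.10 (proof, p. 58)][cite: SerreLocalFields1979, VII §5 Prop. 3]
[cite: NeukirchSchmidtWingberg2008, (8.1.17)] -/
theorem map_evalPointHom_eq_zero_of_mem_shaTwo_real (c : galoisCohomology (ρ.tateDual n) 2)
    (hc : c ∈ shaTwo (ρ.tateDual n)) (m : M) :
    haveI := (presentationLayer ρ).isGalois
    ContinuousCohomology.map (subgroupIncl (absGaloisFixingSubgroup (presentationLayer ρ).1))
      (evalPointHom ρ n hM m) 2 c = 0 := by
  haveI := (presentationLayer ρ).isGalois
  haveI : FiniteDimensional K (presentationLayer ρ).1 := (presentationLayer ρ).finiteDimensional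
  haveI : NumberField (presentationLayer ρ).1 := (presentationLayer ρ).numberField
  haveI := absoluteGaloisGroup_compactSpace K
  haveI := absoluteGaloisGroup_compactSpace (presentationLayer ρ).1
  haveI : CompactSpace (absGaloisFixingSubgroup (presentationLayer ρ).1) :=
    isCompact_iff_compactSpace.mp
      (((absGaloisFixingSubgroup (presentationLayer ρ).1).isClosed_of_isOpen
        (isOpen_absGaloisFixingSubgroup K (presentationLayer ρ).1)).isCompact)
  -- notation: `E = K(M) ⊆ K̄`, `U = Gal(K̄/E) ≤ Γ_K`, `ι = res_{E/K} : Γ_E → Γ_K`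
  set E : IntermediateField K (AlgebraicClosure K) := (presentationLayer ρ).1 with hE
  set U : Subgroup (absoluteGaloisGroup K) := absGaloisFixingSubgroup E with hU
  have hUfix : ∀ (σ : U) (x : M), ρ (σ : absoluteGaloisGroup K) x = x := fun σ x =>
    apply_eq_of_mem_absGaloisFixingSubgroup_presentationLayer ρ σ.2 x
  -- `e : U ≃ₜ* Γ_E`, conjugate to the inclusion by `γ`
  have hUeq : U = galFixing K E := (galFixing_eq_absGaloisFixingSubgroup E).symm
  let eU : U ≃ₜ* galFixing K E :=
    { MulEquiv.subgroupCongr hUeq with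
      continuous_toFun := Continuous.subtype_mk continuous_subtype_val _
      continuous_invFun := Continuous.subtype_mk continuous_subtype_val _ }
  let e₀ : galFixing K E ≃ₜ* absoluteGaloisGroup E :=
    show E.fixingSubgroup ≃ₜ* absoluteGaloisGroup E from fixingSubgroupEquivAbsoluteGaloisGroup E
  let e : U ≃ₜ* absoluteGaloisGroup E := eU.trans e₀
  obtain ⟨γ, hγ⟩ := exists_absGaloisRestrict_fixingSubgroupEquivAbsoluteGaloisGroup_eq_conj K E
  have he : ∀ σ : U, absGaloisRestrict K E (e σ) = γ * (σ : absoluteGaloisGroup K) * γ⁻¹ := fun σ => by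
    have hσ : (σ : absoluteGaloisGroup K) ∈ galFixing K E := by rw [← hUeq]; exact σ.2
    exact hγ ⟨σ.1, hσ⟩
  have hι : ∀ τ : absoluteGaloisGroup E,
      absGaloisRestrict K E τ = γ * ((e.symm τ : U) : absoluteGaloisGroup K) * γ⁻¹ := fun τ => by
    conv_lhs => rw [← e.apply_symm_apply τ]
    exact he _
  have hfixι : ∀ (τ : absoluteGaloisGroup E) (x : M), ρ (absGaloisRestrict K E τ) x = x := fun τ x => by
    rw [hι, map_mul, map_mul, Module.End.mul_apply, Module.End.mul_apply, hUfix, ← Module.End.mul_apply, ← map_mul,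
      mul_inv_cancel, map_one, Module.End.one_apply]
  -- Step A (§2): `H²(ι, ι_E ∘ ev_{m'})(c) = 0` in `H²(E, Ēˣ)` for every `m'`
  let Fm : ∀ m' : M, TopRep.res (absGaloisRestrict K E : absoluteGaloisGroup E →* absoluteGaloisGroup K)
      (ρ.tateDual n).toTopRep ⟶ (units E).toTopRep := fun m' =>
    TopRep.ofHom ⟨{ toLinearMap :=
                      ({ toFun := fun φ : TateDual K M n => unitsTransferAddHom K E (kummerInclAddHom K n (φ m'))
                         map_zero' := by
                           change unitsTransferAddHom K E (kummerInclAddHom K n 0) = 0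
                           rw [map_zero, map_zero]
                         map_add' := fun φ ψ =>
                           map_add ((unitsTransferAddHom K E).comp (kummerInclAddHom K n)) (φ m') (ψ m') } :
                        TateDual K M n →+ UnitsCarrier E).toIntLinearMap
                    cont := continuous_of_discreteTopology }, fun τ => by
      refine ContinuousLinearMap.ext fun φ => ?_
      change unitsTransferAddHom K E (kummerInclAddHom K n ((ρ.tateDual n) (absGaloisRestrict K E τ) φ m')) =
        units E τ (unitsTransferAddHom K E (kummerInclAddHom K n (φ m')))
      rw [DiscreteGaloisModule.tateDual_apply_apply_apply, ← map_inv, hfixι, ← units_kummerInclAddHom,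
        unitsTransferAddHom_smul]⟩
  have hA : ∀ m' : M, ContinuousCohomology.map (absGaloisRestrict K E) (Fm m') 2 c = 0 := fun m' =>
    map_absGaloisRestrict_units_eq_zero_of_mem_shaTwo_real (ρ.tateDual n) E (Fm m') c hc
  -- Step B: the comparison `Φ = H²(e⁻¹, u ↦ ι_E (γ u))` and its left inverse `Ψ = H²(e, u' ↦ γ⁻¹ ι_E⁻¹ u')`
  let uT : UnitsCarrier K ≃+ UnitsCarrier E :=
    AddEquiv.ofBijective (unitsTransferAddHom K E) (unitsTransferAddHom_bijective (K := K) E)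
  have huT : ∀ u, uT u = unitsTransferAddHom K E u := fun _ => rfl
  let gU : TopRep.res ((e.symm : absoluteGaloisGroup E →ₜ* U) : absoluteGaloisGroup E →* U)
      ((units K).restrict (subgroupIncl U)).toTopRep ⟶ (units E).toTopRep :=
    TopRep.ofHom ⟨{ toLinearMap := ((uT : UnitsCarrier K →+ UnitsCarrier E).comp
                        (units K γ : UnitsCarrier K →ₗ[ℤ] UnitsCarrier K).toAddMonoidHom).toIntLinearMap
                    cont := continuous_of_discreteTopology }, fun τ => by
      refine ContinuousLinearMap.ext fun u => ?_
      change uT (units K γ (units K ((e.symm τ : U) : absoluteGaloisGroup K) u)) = units E τ (uT (units K γ u))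
      rw [huT, huT, ← unitsTransferAddHom_smul, hι, ← Module.End.mul_apply, ← map_mul, ← Module.End.mul_apply,
        ← map_mul]
      congr 2
      group⟩
  let gU' : TopRep.res ((e : U →ₜ* absoluteGaloisGroup E) : U →* absoluteGaloisGroup E) (units E).toTopRep ⟶
      ((units K).restrict (subgroupIncl U)).toTopRep :=
    TopRep.ofHom ⟨{ toLinearMap := ((units K γ⁻¹ : UnitsCarrier K →ₗ[ℤ] UnitsCarrier K).toAddMonoidHom.comp
                        (uT.symm : UnitsCarrier E →+ UnitsCarrier K)).toIntLinearMap
                    cont := continuous_of_discreteTopology }, fun σ => by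
      refine ContinuousLinearMap.ext fun u' => ?_
      obtain ⟨u, rfl⟩ := uT.surjective u'
      change units K γ⁻¹ (uT.symm (units E (e σ) (uT u))) = units K (σ : absoluteGaloisGroup K) (units K γ⁻¹ (uT.symm (uT u)))
      rw [uT.symm_apply_apply, huT, ← unitsTransferAddHom_smul, ← huT, uT.symm_apply_apply, he,
        ← Module.End.mul_apply, ← map_mul, ← Module.End.mul_apply, ← map_mul]
      congr 2
      group⟩
  have hΨΦ : ∀ y, ContinuousCohomology.map (e : U →ₜ* absoluteGaloisGroup E) gU' 2
      (ContinuousCohomology.map (e.symm : absoluteGaloisGroup E →ₜ* U) gU 2 y) = y := fun y => by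
    rw [← map_comp_apply_of (e.symm : absoluteGaloisGroup E →ₜ* U) (e : U →ₜ* absoluteGaloisGroup E)
      (ContinuousMonoidHom.id _) (fun σ => (e.symm_apply_apply σ).symm) gU gU'
      (TopRep.ofHom ⟨ContinuousLinearMap.id ℤ (UnitsCarrier K), fun _ => rfl⟩) (fun u => ?_) 2 y]
    · exact map_id_id_two _ y
    · change u = units K γ⁻¹ (uT.symm (uT (units K γ u)))
      rw [uT.symm_apply_apply, ← Module.End.mul_apply, ← map_mul, inv_mul_cancel, map_one, Module.End.one_apply]
  -- Step C: `Φ (H²(U ↪ Γ_K, ev_m) c) = H²(θ, f₁)(c) = H²(ι, Fm (γ m))(c) = 0`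
  let θ : absoluteGaloisGroup E →ₜ* absoluteGaloisGroup K :=
    (subgroupIncl U).comp (e.symm : absoluteGaloisGroup E →ₜ* U)
  have hθ : ∀ τ, θ τ = γ⁻¹ * absGaloisRestrict K E τ * γ := fun τ => by
    change ((e.symm τ : U) : absoluteGaloisGroup K) = _
    rw [hι]
    group
  let f₁ : TopRep.res (θ : absoluteGaloisGroup E →* absoluteGaloisGroup K) (ρ.tateDual n).toTopRep ⟶
      (units E).toTopRep :=
    TopRep.ofHom ⟨{ toLinearMap :=
                      ({ toFun := fun φ : TateDual K M n => uT (units K γ (kummerInclAddHom K n (φ m)))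
                         map_zero' := by
                           change uT (units K γ (kummerInclAddHom K n 0)) = 0
                           rw [map_zero, map_zero, map_zero]
                         map_add' := fun φ ψ =>
                           map_add (((uT : UnitsCarrier K →+ UnitsCarrier E).comp
                             (units K γ : UnitsCarrier K →ₗ[ℤ] UnitsCarrier K).toAddMonoidHom).comp
                               (kummerInclAddHom K n)) (φ m) (ψ m) } :
                        TateDual K M n →+ UnitsCarrier E).toIntLinearMap
                    cont := continuous_of_discreteTopology }, fun τ => by
      refine ContinuousLinearMap.ext fun φ => ?_
      change uT (units K γ (kummerInclAddHom K n ((ρ.tateDual n) (θ τ) φ m))) =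
        units E τ (uT (units K γ (kummerInclAddHom K n (φ m))))
      rw [DiscreteGaloisModule.tateDual_apply_apply_apply, ← map_inv, show ρ (θ τ⁻¹) m = m from hUfix _ m,
        ← units_kummerInclAddHom, huT, huT, ← unitsTransferAddHom_smul, hθ, hι, ← Module.End.mul_apply, ← map_mul,
        ← Module.End.mul_apply, ← map_mul]
      congr 2
      group⟩
  have h1 : ContinuousCohomology.map (e.symm : absoluteGaloisGroup E →ₜ* U) gU 2
      (ContinuousCohomology.map (subgroupIncl U) (evalPointHom ρ n hM m) 2 c) =
        ContinuousCohomology.map θ f₁ 2 c :=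
    (map_comp_apply_of (subgroupIncl U) (e.symm : absoluteGaloisGroup E →ₜ* U) θ (fun _ => rfl)
      (evalPointHom ρ n hM m) gU f₁ (fun _ => rfl) 2 c).symm
  have h2 : ContinuousCohomology.map θ f₁ 2 c = ContinuousCohomology.map (absGaloisRestrict K E) (Fm (ρ γ m)) 2 c :=
    map_eq_map_of_inner_two γ (absGaloisRestrict K E) θ hθ f₁ (Fm (ρ γ m)) (fun φ => by
      change uT (units K γ (kummerInclAddHom K n (φ m))) =
        unitsTransferAddHom K E (kummerInclAddHom K n ((ρ.tateDual n) γ φ (ρ γ m)))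
      rw [DiscreteGaloisModule.tateDual_apply_apply_apply, ← Module.End.mul_apply, ← map_mul, inv_mul_cancel, map_one,
        Module.End.one_apply, ← units_kummerInclAddHom, huT]) c
  rw [← hΨΦ (ContinuousCohomology.map (subgroupIncl U) (evalPointHom ρ n hM m) 2 c), h1, h2, hA]
  exact map_zero _

end Transport

/-! ## §4 (A) at every number field -/

section Final

variable {K : Type} [Field K] [NumberField K]

open Literature.NumberTheory.GaloisRepresentations.HomDual (localGlobal_of_forall_evalPoint tateDualUnitsIso dualF)
open Literature.NumberTheory.GaloisRepresentations.FreePresentation (presModule₂ presProj moduleFinite_presModule₂)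
open Literature.Algebra.Homology Literature.Algebra.Homology.DiscreteRep

/-- **Hypothesis (A) of `poitouTate_sha_tateDual_of_localGlobal` at EVERY number field `K`** (real places allowed):
for every finite `n`-torsion `M` and `c ∈ Ш²(K, M^D)`, `H²(p^*)(H²(e) c) = 0 ∈ H²(K, Hom_ℤ(P, K̄ˣ))` — inf–res +
Hilbert 90 (`localGlobal_of_forall_evalPoint`) and (A3) at every `K` (`map_evalPointHom_eq_zero_of_mem_shaTwo_real`).
This is VERBATIM the binder `hA` of `poitouTate_sha_tateDual_of_bridge_of_localGlobal'` (bsd-inputs-k4-p1) and of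
`poitouTate_sha_tateDual_of_R4_A` , now without `IsTotallyComplex`.
[cite: MilneADT2006, I Thm. 4.10 (proof, p. 58)][cite: NeukirchSchmidtWingberg2008, (8.1.17)] -/
theorem tateDual_localGlobal_real {M : Type} [AddCommGroup M] [TopologicalSpace M] [DiscreteTopology M]
    [Finite M] (ρ : DiscreteGaloisModule K M) (n : ℕ) (hM : ∀ m : M, n • m = 0) :
    haveI := moduleFinite_presModule₂ ρ
    ∀ c ∈ shaTwo (ρ.tateDual n),
      cohomologyMap (dualF (presModule₂ ρ) ρ (units K) (presProj ρ)) 2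
        (cohomologyMap (tateDualUnitsIso K ρ n hM).hom 2 c) = 0 :=
  localGlobal_of_forall_evalPoint ρ n hM fun c hc m => map_evalPointHom_eq_zero_of_mem_shaTwo_real ρ n hM c hc m

end Final

end Literature.NumberTheory.GaloisCohomology.PoitouTateFinite.PoitouTateShaTwoReadout

end Part1

/-!
## Part 2 — port of `Summits/BirchSwinnertonDyer/BirchSwinnertonDyer/Theorems/ThetaPartnerAtTwoSignedControlAtTwoMuRealShaDualAnnihilator.lean` (3 declarations kept)

# Poitou–Tate at fields WITH REAL PLACES: the annihilator of `Ш¹(K, M^D)` is the image of `γ¹` — archimedean components live — and the perfect pairing `Ш²(K, M) × Ш¹(K, M^D) → ℤ/n` from a readout (Milne ADT I Thm. 4.10 (a))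

Declarations of this Part (verbatim port; each keeps its own docstring and citation): `exists_archimedean_localTatePairing_correction`, `exists_family_sum_localTatePairing_eq_real`, `sha_tateDual_of_readout_real`.

Reference keys (see `references.bib` and the declarations' citations): [MilneADT2006], [Lam1999], [Howard2004HeegnerKolyvagin], [Harari2020].
-/

section Part2

open _root_.Function _root_.NumberField _root_.IsDedekindDomain
open scoped _root_.NumberField

universe u

set_option autoImplicit false

namespace Literature.NumberTheory.GaloisCohomology.PoitouTateFinite.SignedEC.MuReal

open Literature.NumberTheory.GaloisRepresentations
open Literature.NumberTheory.GaloisRepresentations.DiscreteGaloisModule (mu localTatePairingZMod tateDual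
  unramifiedSubgroup sha shaTwo)
open Literature.NumberTheory.GaloisCohomology
open Literature.NumberTheory.GaloisCohomology.PoitouTateFinite.PoitouTateShaAnnihilator
  (exists_family_sum_localTatePairing_eq exists_addMonoidHom_extend_of_nsmul_eq_zero)
open Literature.NumberTheory.GaloisCohomology.PoitouTateFinite.PoitouTateReduction
  (bijective_localTatePairingZMod_place pi_nsmul_eq_zero)

variable {K : Type u} [Field K] [NumberField K] {M : Type u} [AddCommGroup M] [TopologicalSpace M]
  [DiscreteTopology M] [Finite M] {n : ℕ} [NeZero n]

section Archimedean

/-- **Archimedean correction of a functional vanishing on `Ш¹(K, M^D)`.**  For a family `inv` of local invariant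
maps perfect at the finite places and injective at the real places, a finite `n`-torsion `M`, and an additive
`φ : H¹(K, M^D) → ℤ/n` vanishing on `Ш¹(K, M^D)` (the classes vanishing at ALL places): there is an archimedean family
`t∞_w ∈ H¹(K_w, M)` (`w ∣ ∞`) with `φ(y) = ∑_{w ∣ ∞} inv_w (t∞_w ∪ y_w)` for every `y` vanishing at all FINITE places.
(On those classes `φ` factors through `y ↦ (y_w)_{w ∣ ∞} ∈ ∏_w H¹(K_w, M^D)`, its kernel there being `Ш¹`; extend the
factor to the finite `n`-torsion group `∏_w H¹(K_w, M^D)` — `ℤ/n` is self-injective — and represent each coordinate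
functional by the archimedean local Tate duality, Milne I Thm. 2.13 (a); complex coordinates vanish.)
[cite: MilneADT2006, Ch. I, Thm. 2.13 (a) (p. 35), Ex. 1.6 (c) (p. 19), Prop. 0.19] [cite: Lam1999, §15] -/
theorem exists_archimedean_localTatePairing_correction {inv : LocalInvariants K n} (hperf : inv.IsPerfect)
    (hreal : inv.InjectiveAtRealPlaces) (ρ : DiscreteGaloisModule K M) (hM : ∀ m : M, n • m = 0)
    (φ : galoisCohomology (ρ.tateDual n) 1 →+ ZMod n)
    (hφ : ∀ y ∈ sha (ρ.tateDual n), φ y = 0) :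
    ∃ tinf : Π w : InfinitePlace K, galoisCohomology (ρ.toLocal (Sum.inl w)) 1,
      ∀ y : galoisCohomology (ρ.tateDual n) 1,
        (∀ v : HeightOneSpectrum (𝓞 K), galoisCohomology.localization (ρ.tateDual n) (Sum.inr v) 1 y = 0) →
        φ y = ∑ w : InfinitePlace K, localTatePairingZMod ρ n (Sum.inl w) (inv (Sum.inl w)) (tinf w)
          (galoisCohomology.localization (ρ.tateDual n) (Sum.inl w) 1 y) := by
  classical
  -- the classes vanishing at the finite places, and the archimedean localisation on them
  let V : AddSubgroup (galoisCohomology (ρ.tateDual n) 1) :=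
    (AddMonoidHom.pi fun v : HeightOneSpectrum (𝓞 K) =>
      galoisCohomology.localization (ρ.tateDual n) (Sum.inr v) 1).ker
  have hV : ∀ y : galoisCohomology (ρ.tateDual n) 1, y ∈ V ↔
      ∀ v : HeightOneSpectrum (𝓞 K), galoisCohomology.localization (ρ.tateDual n) (Sum.inr v) 1 y = 0 := by
    intro y
    rw [AddMonoidHom.mem_ker]
    exact ⟨fun h v => congr_fun h v, fun h => funext h⟩
  let L : galoisCohomology (ρ.tateDual n) 1 →+
      Π w : InfinitePlace K, galoisCohomology ((ρ.tateDual n).toLocal (Sum.inl w)) 1 :=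
    AddMonoidHom.pi fun w : InfinitePlace K => galoisCohomology.localization (ρ.tateDual n) (Sum.inl w) 1
  have hL : ∀ (y : galoisCohomology (ρ.tateDual n) 1) (w : InfinitePlace K),
      L y w = galoisCohomology.localization (ρ.tateDual n) (Sum.inl w) 1 y := fun _ _ => rfl
  let LV : V →+ Π w : InfinitePlace K, galoisCohomology ((ρ.tateDual n).toLocal (Sum.inl w)) 1 :=
    L.comp V.subtype
  let f : V →+ LV.range := LV.rangeRestrict
  have hf : Surjective f := LV.rangeRestrict_surjective
  -- `φ|_V` kills `Ker (V → ∏_w H¹(K_w, M^D)) = Ш¹(K, M^D)`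
  have hker : f.ker ≤ (φ.comp V.subtype).ker := by
    intro y hy
    rw [AddMonoidHom.mem_ker] at hy ⊢
    have hy0 : LV y = 0 := by
      have := congrArg Subtype.val hy
      simpa [f] using this
    rw [AddMonoidHom.comp_apply]
    refine hφ _ ((DiscreteGaloisModule.mem_sha_iff _ _).2 fun v => ?_)
    cases v with
    | inl w =>
      have := congr_fun hy0 w
      simpa [LV, hL] using this
    | inr v => exact (hV _).1 y.2 v
  -- the factor `χ` on the image, extended to `Φ` on the whole finite product
  let χ : LV.range →+ ZMod n := f.liftOfSurjective hf ⟨φ.comp V.subtype, hker⟩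
  have hχ : ∀ y : V, χ (f y) = φ y := fun y =>
    f.liftOfRightInverse_comp_apply (surjInv hf) (rightInverse_surjInv hf) ⟨φ.comp V.subtype, hker⟩ y
  haveI : Finite (DiscreteGaloisModule.TateDual K M n) := DiscreteGaloisModule.TateDual.finite K M n
  have hPiN : ∀ p : Π w : InfinitePlace K, galoisCohomology ((ρ.tateDual n).toLocal (Sum.inl w)) 1, n • p = 0 :=
    pi_nsmul_eq_zero fun w x => galoisCohomology.nsmul_eq_zero_of_forall _
      (fun g => DiscreteGaloisModule.TateDual.nsmul_eq_zero g) x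
  obtain ⟨Φ, hΦ⟩ := exists_addMonoidHom_extend_of_nsmul_eq_zero hPiN LV.range χ
  -- coordinatewise representation by the archimedean local Tate duality
  have hrep : ∀ w : InfinitePlace K, ∃ t : galoisCohomology (ρ.toLocal (Sum.inl w)) 1,
      localTatePairingZMod ρ n (Sum.inl w) (inv (Sum.inl w)) t =
        Φ.comp (AddMonoidHom.single (fun w : InfinitePlace K =>
          galoisCohomology ((ρ.tateDual n).toLocal (Sum.inl w)) 1) w) :=
    fun w => (bijective_localTatePairingZMod_place inv hperf hreal ρ hM (Sum.inl w)).1.2 _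
  choose tinf htinf using hrep
  refine ⟨tinf, fun y hy => ?_⟩
  have hyV : y ∈ V := (hV y).2 hy
  have h1 : φ y = Φ (L y) := by
    have h := hχ ⟨y, hyV⟩
    rw [← hΦ] at h
    rw [← h]
    rfl
  rw [h1, ← Finset.univ_sum_single (L y), map_sum]
  refine Finset.sum_congr rfl fun w _ => ?_
  rw [htinf w, AddMonoidHom.comp_apply, AddMonoidHom.single_apply, hL]

end Archimedean

section Main

/-- **The annihilator of `Ш¹(K, M^D)` consists of sums of local Tate pairings — ANY number field, real places
included** (Milne I Thm. 4.10: the step (b) ⟹ (a), `Ш¹(K, M^D)^⊥ ⊆ γ¹(P¹(K, M))` with Milne's `P¹ ∋` the real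
places).  Let `inv` be a family of local invariant maps with `IsPerfect` (finite places), `InjectiveAtRealPlaces`
(Milne I Ex. 1.6 (c)), `UnramifiedOrthogonal` (Thm. 2.6) and `SelmerComplement` (Howard Thm. 2.1.11); `M` a finite
discrete `Γ_K`-module killed by `n ≥ 1`, unramified outside the finite `S₀ ⊇ {v ∣ ∞} ∪ {v ∣ n}`; and
`φ : H¹(K, M^D) →+ ℤ/n` additive, vanishing on `Ш¹(K, M^D)`.  Then there are a finite `S₁ ⊇ S₀` and ONE family
`t_v ∈ H¹(K_v, M)` (`v` over ALL places, archimedean components unrestricted), unramified at the finite places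
outside `S₁`, with `φ(y) = ∑_{v ∈ S} inv_v (t_v ∪ loc_v y)` for every `y ∈ H¹(K, M^D)` and every finite `S ⊇ S₁`
off which `y` is unramified.  (Proof: subtract the archimedean correction of §1; the difference kills every class
vanishing at the finite places, so the tree's finite-place theorem `exists_family_sum_localTatePairing_eq` applies.)
[cite: MilneADT2006, Ch. I, Thm. 4.10 (a)(b) and proof (p. 57–58), §4 (p. 55), Thm. 2.13 (a), Ex. 1.6 (c)]
[cite: Howard2004HeegnerKolyvagin, Thm. 2.1.11 (arXiv:1202.6340 p. 6)] -/
theorem exists_family_sum_localTatePairing_eq_real {inv : LocalInvariants K n} (hperf : inv.IsPerfect)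
    (hreal : inv.InjectiveAtRealPlaces) (hur : inv.UnramifiedOrthogonal) (hcomp : inv.SelmerComplement)
    (ρ : DiscreteGaloisModule K M) (hM : ∀ m : M, n • m = 0)
    (S₀ : Finset (Place K)) (hinf : ∀ w : InfinitePlace K, (Sum.inl w : Place K) ∈ S₀)
    (hS₀ : ∀ v : HeightOneSpectrum (𝓞 K), (Sum.inr v : Place K) ∉ S₀ →
      ((n : ℕ) : 𝓞 K) ∉ v.asIdeal ∧ GaloisRep.IsUnramifiedAt v ρ)
    (φ : galoisCohomology (ρ.tateDual n) 1 →+ ZMod n)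
    (hφ : ∀ y ∈ sha (ρ.tateDual n), φ y = 0) :
    ∃ (S₁ : Finset (Place K)) (t : Π v : Place K, galoisCohomology (ρ.toLocal v) 1),
      S₀ ⊆ S₁ ∧
      (∀ v : HeightOneSpectrum (𝓞 K), (Sum.inr v : Place K) ∉ S₁ →
        t (Sum.inr v) ∈ unramifiedSubgroup (GaloisRep.toLocal v ρ) 1) ∧
      ∀ (y : galoisCohomology (ρ.tateDual n) 1) (S : Finset (Place K)), S₁ ⊆ S →
        (∀ v : HeightOneSpectrum (𝓞 K), (Sum.inr v : Place K) ∉ S →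
          galoisCohomology.localization (ρ.tateDual n) (Sum.inr v) 1 y ∈
            unramifiedSubgroup (GaloisRep.toLocal v (ρ.tateDual n)) 1) →
        φ y = ∑ v ∈ S, localTatePairingZMod ρ n v (inv v) (t v)
          (galoisCohomology.localization (ρ.tateDual n) v 1 y) := by
  classical
  obtain ⟨tinf, htinf⟩ := exists_archimedean_localTatePairing_correction hperf hreal ρ hM φ hφ
  -- the corrected functional kills every class vanishing at the finite places
  let arch : galoisCohomology (ρ.tateDual n) 1 →+ ZMod n :=
    ∑ w : InfinitePlace K, (localTatePairingZMod ρ n (Sum.inl w) (inv (Sum.inl w)) (tinf w)).comp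
      (galoisCohomology.localization (ρ.tateDual n) (Sum.inl w) 1)
  have harch : ∀ y, arch y = ∑ w : InfinitePlace K, localTatePairingZMod ρ n (Sum.inl w) (inv (Sum.inl w))
      (tinf w) (galoisCohomology.localization (ρ.tateDual n) (Sum.inl w) 1 y) := fun y => by
    simp only [arch, AddMonoidHom.finsetSum_apply, AddMonoidHom.comp_apply]
  obtain ⟨S₁, t₀, hS₀S₁, ht₀inl, ht₀ur, hformula⟩ :=
    exists_family_sum_localTatePairing_eq hperf hur hcomp ρ hM S₀ hinf hS₀ (φ - arch) fun y hy => by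
      rw [AddMonoidHom.sub_apply, harch, htinf y hy, sub_self]
  -- splice the archimedean family into `t₀`
  let t : Π v : Place K, galoisCohomology (ρ.toLocal v) 1 := fun v =>
    match v with
    | Sum.inl w => tinf w
    | Sum.inr v' => t₀ (Sum.inr v')
  refine ⟨S₁, t, hS₀S₁, fun v hv => ht₀ur v hv, fun y S hS₁S hy => ?_⟩
  have hmain := hformula y S hS₁S hy
  rw [AddMonoidHom.sub_apply, sub_eq_iff_eq_add, harch] at hmain
  rw [hmain]
  let h : Place K → ZMod n := fun v =>
    match v with
    | Sum.inl w => localTatePairingZMod ρ n (Sum.inl w) (inv (Sum.inl w)) (tinf w)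
        (galoisCohomology.localization (ρ.tateDual n) (Sum.inl w) 1 y)
    | Sum.inr _ => 0
  have hsplit : ∀ v ∈ S, localTatePairingZMod ρ n v (inv v) (t v)
      (galoisCohomology.localization (ρ.tateDual n) v 1 y) =
      localTatePairingZMod ρ n v (inv v) (t₀ v) (galoisCohomology.localization (ρ.tateDual n) v 1 y) + h v := by
    intro v _
    cases v with
    | inl w => simp only [t, h, ht₀inl w, map_zero, AddMonoidHom.zero_apply, zero_add]
    | inr v => simp only [t, h, add_zero]
  rw [Finset.sum_congr rfl hsplit, Finset.sum_add_distrib]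
  congr 1
  have hsub : (Finset.univ : Finset (InfinitePlace K)).map ⟨Sum.inl, Sum.inl_injective⟩ ⊆ S := by
    intro v hv
    rw [Finset.mem_map] at hv
    obtain ⟨w, -, rfl⟩ := hv
    exact hS₁S (hS₀S₁ (hinf w))
  rw [← Finset.sum_subset hsub (fun v _ hv => ?_), Finset.sum_map]
  · rfl
  · cases v with
    | inl w => exact absurd (Finset.mem_map.2 ⟨w, Finset.mem_univ w, rfl⟩) hv
    | inr v => rfl

end Main

section Perfect

/-- **`Ш²(K, M) × Ш¹(K, M^D) → ℤ/n` is perfect, from a readout of `Ш²` that is additive, injective and surjective modulo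
sums of local pairings — ANY number field `K`** (Milne I Thm. 4.10 (a) for the module `M`; the real-place version of
`PoitouTateShaAnnihilator.sha_tateDual_of_readout`).  Hypotheses: `inv` with `IsPerfect`, `InjectiveAtRealPlaces`,
`UnramifiedOrthogonal`, `SelmerComplement`; `M` finite `n`-torsion unramified off the finite `S₀ ⊇ {v ∣ ∞} ∪ {v ∣ n}`;
`Ш¹(K, M^D)` finite; `e : Ш²(K, M) → Hom(H¹(K, M^D), ℤ/n)` with (add) `e(c + c') − e(c) − e(c')` a local sum on the
classes unramified off some finite `S₁`; (inj) `e(c)` a local sum against a family unramified off some `S₁ ⊇ S₀`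
(archimedean components ARBITRARY) ⟹ `c = 0`; (surj) every additive `φ` is `e(c) +` a local sum for some `c`.
CONCLUSION: `Ш²(K, M)` is finite and `b(c, y) = e(c)(y)` on `Ш²(K, M) × Ш¹(K, M^D)` has both adjoints bijective — the
existential conclusion of `poitouTate_sha_tateDual K` at `(n, M, ρ)`.
[cite: MilneADT2006, Ch. I, Thm. 4.10 (a) and proof, §0 Prop. 0.19, Thm. 2.13 (a)] [cite: Harari2020, Thm. 17.13 (b)] -/
theorem sha_tateDual_of_readout_real
    {inv : LocalInvariants K n} (hperf : inv.IsPerfect) (hreal : inv.InjectiveAtRealPlaces)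
    (hur : inv.UnramifiedOrthogonal) (hcomp : inv.SelmerComplement)
    (ρ : DiscreteGaloisModule K M) (hM : ∀ m : M, n • m = 0)
    (S₀ : Finset (Place K)) (hinf : ∀ w : InfinitePlace K, (Sum.inl w : Place K) ∈ S₀)
    (hS₀ : ∀ v : HeightOneSpectrum (𝓞 K), (Sum.inr v : Place K) ∉ S₀ →
      ((n : ℕ) : 𝓞 K) ∉ v.asIdeal ∧ GaloisRep.IsUnramifiedAt v ρ)
    [Finite (sha (ρ.tateDual n))]
    (e : shaTwo ρ → (galoisCohomology (ρ.tateDual n) 1 →+ ZMod n))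
    (hadd : ∀ c c' : shaTwo ρ, ∃ (S₁ : Finset (Place K)) (t : Π v : Place K, galoisCohomology (ρ.toLocal v) 1),
      ∀ (y : galoisCohomology (ρ.tateDual n) 1) (S : Finset (Place K)), S₁ ⊆ S →
        (∀ v : HeightOneSpectrum (𝓞 K), (Sum.inr v : Place K) ∉ S →
          galoisCohomology.localization (ρ.tateDual n) (Sum.inr v) 1 y ∈
            unramifiedSubgroup (GaloisRep.toLocal v (ρ.tateDual n)) 1) →
        (e (c + c') - e c - e c') y = ∑ v ∈ S, localTatePairingZMod ρ n v (inv v) (t v)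
          (galoisCohomology.localization (ρ.tateDual n) v 1 y))
    (hinj : ∀ c : shaTwo ρ, (∃ (S₁ : Finset (Place K)) (t : Π v : Place K, galoisCohomology (ρ.toLocal v) 1),
      S₀ ⊆ S₁ ∧
      (∀ v : HeightOneSpectrum (𝓞 K), (Sum.inr v : Place K) ∉ S₁ →
        t (Sum.inr v) ∈ unramifiedSubgroup (GaloisRep.toLocal v ρ) 1) ∧
      ∀ (y : galoisCohomology (ρ.tateDual n) 1) (S : Finset (Place K)), S₁ ⊆ S →
        (∀ v : HeightOneSpectrum (𝓞 K), (Sum.inr v : Place K) ∉ S →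
          galoisCohomology.localization (ρ.tateDual n) (Sum.inr v) 1 y ∈
            unramifiedSubgroup (GaloisRep.toLocal v (ρ.tateDual n)) 1) →
        e c y = ∑ v ∈ S, localTatePairingZMod ρ n v (inv v) (t v)
          (galoisCohomology.localization (ρ.tateDual n) v 1 y)) → c = 0)
    (hsurj : ∀ φ : galoisCohomology (ρ.tateDual n) 1 →+ ZMod n, ∃ (c : shaTwo ρ) (S₁ : Finset (Place K))
      (t : Π v : Place K, galoisCohomology (ρ.toLocal v) 1),
      ∀ (y : galoisCohomology (ρ.tateDual n) 1) (S : Finset (Place K)), S₁ ⊆ S →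
        (∀ v : HeightOneSpectrum (𝓞 K), (Sum.inr v : Place K) ∉ S →
          galoisCohomology.localization (ρ.tateDual n) (Sum.inr v) 1 y ∈
            unramifiedSubgroup (GaloisRep.toLocal v (ρ.tateDual n)) 1) →
        (φ - e c) y = ∑ v ∈ S, localTatePairingZMod ρ n v (inv v) (t v)
          (galoisCohomology.localization (ρ.tateDual n) v 1 y)) :
    Finite (shaTwo ρ) ∧ ∃ b : shaTwo ρ →+ sha (ρ.tateDual n) →+ ZMod n,
      (∀ (c : shaTwo ρ) (y : sha (ρ.tateDual n)), b c y = e c y) ∧ Bijective b ∧ Bijective b.flip := by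
  classical
  -- local sums vanish on `Ш¹(K, M^D)`
  have hsha_loc : ∀ y : sha (ρ.tateDual n), ∀ v : Place K,
      galoisCohomology.localization (ρ.tateDual n) v 1 (y : galoisCohomology (ρ.tateDual n) 1) = 0 :=
    fun y v => (DiscreteGaloisModule.mem_sha_iff _ _).1 y.2 v
  have hsha_ur : ∀ (y : sha (ρ.tateDual n)) (S : Finset (Place K)),
      ∀ v : HeightOneSpectrum (𝓞 K), (Sum.inr v : Place K) ∉ S →
        galoisCohomology.localization (ρ.tateDual n) (Sum.inr v) 1 (y : galoisCohomology (ρ.tateDual n) 1) ∈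
          unramifiedSubgroup (GaloisRep.toLocal v (ρ.tateDual n)) 1 :=
    fun y S v _ => by rw [hsha_loc y (Sum.inr v)]; exact AddSubgroup.zero_mem _
  have hlocal0 : ∀ (S : Finset (Place K)) (t : Π v : Place K, galoisCohomology (ρ.toLocal v) 1)
      (y : sha (ρ.tateDual n)),
      ∑ v ∈ S, localTatePairingZMod ρ n v (inv v) (t v)
        (galoisCohomology.localization (ρ.tateDual n) v 1 (y : galoisCohomology (ρ.tateDual n) 1)) = 0 :=
    fun S t y => Finset.sum_eq_zero fun v _ => by rw [hsha_loc y v, map_zero]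
  have hshaN : ∀ y : sha (ρ.tateDual n), n • y = 0 := fun y => Subtype.ext (by
    rw [AddSubgroup.coe_nsmul, AddSubgroup.coe_zero]
    exact galoisCohomology.nsmul_eq_zero_of_forall _
      (fun f => DiscreteGaloisModule.TateDual.nsmul_eq_zero f) _)
  -- the pairing `b(c, y) = e(c)(y)`
  have hR_add : ∀ c c' : shaTwo ρ, (e (c + c')).comp (sha (ρ.tateDual n)).subtype =
      (e c).comp (sha (ρ.tateDual n)).subtype + (e c').comp (sha (ρ.tateDual n)).subtype := by
    intro c c'
    obtain ⟨S₁, t, h⟩ := hadd c c'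
    ext y
    have hy := h (y : galoisCohomology (ρ.tateDual n) 1) S₁ le_rfl (hsha_ur y S₁)
    rw [hlocal0] at hy
    simp only [AddMonoidHom.sub_apply] at hy
    simp only [AddMonoidHom.comp_apply, AddSubgroup.coe_subtype, AddMonoidHom.add_apply]
    rw [sub_sub, sub_eq_zero] at hy
    rw [hy]
  let b : shaTwo ρ →+ (sha (ρ.tateDual n) →+ ZMod n) :=
    { toFun := fun c => (e c).comp (sha (ρ.tateDual n)).subtype
      map_zero' := by
        have h := hR_add 0 0
        rw [add_zero] at h
        exact left_eq_add.1 h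
      map_add' := hR_add }
  have hb : ∀ (c : shaTwo ρ) (y : sha (ρ.tateDual n)), b c y = e c y := fun _ _ => rfl
  -- injective: a readout vanishing on `Ш¹` is a local sum (§2, archimedean components live), hence `c = 0` by (inj)
  have hbinj : Injective b := by
    intro c c' hcc'
    rw [← sub_eq_zero]
    apply hinj
    have h0 : b (c - c') = 0 := by rw [map_sub, hcc', sub_self]
    have hφ : ∀ y ∈ sha (ρ.tateDual n), e (c - c') y = 0 := fun y hy => by
      have := DFunLike.congr_fun h0 ⟨y, hy⟩
      rwa [hb] at this
    exact exists_family_sum_localTatePairing_eq_real hperf hreal hur hcomp ρ hM S₀ hinf hS₀ (e (c - c')) hφ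
  -- surjective: extend a character of `Ш¹` to `H¹(K, M^D)` and read it
  have hbsurj : Surjective b := by
    intro χ
    obtain ⟨φ, hφ⟩ := exists_addMonoidHom_extend_of_nsmul_eq_zero
      (galoisCohomology.nsmul_eq_zero_of_forall _ (fun f => DiscreteGaloisModule.TateDual.nsmul_eq_zero f))
      (sha (ρ.tateDual n)) χ
    obtain ⟨c, S₁, t, h⟩ := hsurj φ
    refine ⟨c, ?_⟩
    ext y
    have hy := h (y : galoisCohomology (ρ.tateDual n) 1) S₁ le_rfl (hsha_ur y S₁)
    rw [hlocal0, AddMonoidHom.sub_apply, sub_eq_zero] at hy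
    rw [hb, ← hy, hφ]
  -- `Ш²` is `n`-torsion (it embeds in `Hom(Ш¹, ℤ/n)`) and finite
  have hshaTwoN : ∀ c : shaTwo ρ, n • c = 0 := fun c => hbinj (by
    rw [map_nsmul, map_zero]
    ext y
    rw [AddMonoidHom.nsmul_apply, AddMonoidHom.zero_apply, nsmul_eq_mul, ZMod.natCast_self, zero_mul])
  haveI : Finite (sha (ρ.tateDual n) →+ ZMod n) := finite_addMonoidHom_zmod _ n
  haveI hfin : Finite (shaTwo ρ) := Finite.of_injective b hbinj
  -- the right adjoint is injective: characters of `Ш¹` separate points and `b` is onto them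
  have hbflip : Injective b.flip := by
    intro y y' hyy'
    by_contra hne
    obtain ⟨χ, hχ⟩ := exists_addMonoidHom_zmod_apply_ne_zero hshaN (sub_ne_zero.2 hne)
    obtain ⟨c, rfl⟩ := hbsurj χ
    apply hχ
    have := DFunLike.congr_fun hyy' c
    rw [AddMonoidHom.flip_apply, AddMonoidHom.flip_apply] at this
    rw [map_sub, this, sub_self]
  exact ⟨hfin, b, hb, AddMonoidHom.bijective_of_injective_of_injective_flip hshaTwoN hshaN b hbinj hbflip⟩

end Perfect

end Literature.NumberTheory.GaloisCohomology.PoitouTateFinite.SignedEC.MuReal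

end Part2

/-!
## Part 3 — port of `Summits/BirchSwinnertonDyer/BirchSwinnertonDyer/Theorems/ThetaPartnerAtTwoSignedControlAtTwoShaTwoPrimaryFinite.lean` (1 declarations kept)

# Naturality of localisation in degree `2` at an infinite place

Declarations of this Part (verbatim port; each keeps its own docstring and citation): `localization_inl_map_two`.

Reference keys (see `references.bib` and the declarations' citations): [SerreGaloisCohomology1997].
-/

section Part3

set_option autoImplicit false
open scoped _root_.Classical _root_.NumberField ContRepresentation

open _root_.CategoryTheory _root_.NumberField _root_.IsDedekindDomain _root_.Field _root_.Function _root_.WeierstrassCurve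
open Literature.NumberTheory.EllipticCurves Literature.NumberTheory.GaloisRepresentations
open Literature.NumberTheory.GaloisRepresentations.DiscreteGaloisModule (sha shaTwo mem_sha_iff mem_shaTwo_iff tateDual)
open Literature.NumberTheory.GaloisCohomology

namespace Literature.NumberTheory.GaloisCohomology.PoitouTateFinite.SignedEC.ShaTwo

section Global

variable {K : Type} [Field K] [NumberField K]

/-- **Naturality of localisation in degree `2` at an INFINITE place** (`loc_w ∘ H²(f) = H²(f|_{Γ_{K_w}}) ∘ loc_w`; the finite-place
twin is X11b's `WeakLeopoldt.localization_inr_map_two`). [cite: SerreGaloisCohomology1997, Ch. I §2.4 (functoriality of cohomology in the pair (group, module))] -/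
theorem localization_inl_map_two {M M' : Type} [AddCommGroup M] [TopologicalSpace M] [DiscreteTopology M]
    [AddCommGroup M'] [TopologicalSpace M'] [DiscreteTopology M']
    {ρ : DiscreteGaloisModule K M} {ρ' : DiscreteGaloisModule K M'}
    (f : ρ.toContRepresentation →ⁱL ρ'.toContRepresentation) (w : InfinitePlace K) (x : galoisCohomology ρ 2) :
    galoisCohomology.localization ρ' (Sum.inl w) 2 (galoisCohomology.map f 2 x) =
      galoisCohomology.map (f.restrictField w.Completion) 2 (galoisCohomology.localization ρ (Sum.inl w) 2 x) := by
  haveI : CompactSpace (absoluteGaloisGroup K) := absoluteGaloisGroup_compactSpace K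
  haveI : CompactSpace (absoluteGaloisGroup (Place.Completion (Sum.inl w : Place K))) := absoluteGaloisGroup_compactSpace _
  haveI : CompactSpace (absoluteGaloisGroup w.Completion) := absoluteGaloisGroup_compactSpace _
  obtain ⟨c, rfl⟩ := twoCocycleClass_surjective _ x
  -- localisation on `2`-cocycles at `w`: `loc_w [c] = [c ∘ (res_w × res_w)]`, for `ρ` and `ρ'`
  have loc : ∀ {N : Type} [AddCommGroup N] [TopologicalSpace N] [DiscreteTopology N] (τ : DiscreteGaloisModule K N)
      (d : contTwoCocycles τ.toTopRep),
      galoisCohomology.localization τ (Sum.inl w) 2 (twoCocycleClass τ.toTopRep d) =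
        twoCocycleClass (DiscreteGaloisModule.toTopRep (τ.toLocal (Sum.inl w)))
          (contTwoCocycles.pullback (absGaloisRestrict K w.Completion) (X := τ.toTopRep)
            (Y := DiscreteGaloisModule.toTopRep (τ.toLocal (Sum.inl w)))
            (TopRep.ofHom ⟨ContinuousLinearMap.id ℤ N, fun _ => rfl⟩) d) :=
    fun τ d ↦ map_twoCocycleClass _ _ _ d
  rw [← DiscreteGaloisModule.cohomologyMap_homOfIntertwining, cohomologyMap_twoCocycleClass, loc, loc,
    ← DiscreteGaloisModule.cohomologyMap_homOfIntertwining]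
  refine Eq.trans ?_ (cohomologyMap_twoCocycleClass
    (DiscreteGaloisModule.homOfIntertwining (f.restrictField w.Completion)) _).symm
  exact congrArg (twoCocycleClass _) (Subtype.ext (ContinuousMap.ext fun _ ↦ rfl))

variable (W : WeierstrassCurve K) [W.IsElliptic] (p : ℕ) [Fact p.Prime]

end Global

end Literature.NumberTheory.GaloisCohomology.PoitouTateFinite.SignedEC.ShaTwo

end Part3

/-!
## Part 4 — port of `Summits/BirchSwinnertonDyer/BirchSwinnertonDyer/Theorems/ThetaPartnerAtTwoSignedControlAtTwoShaTwoNativeAssemblyReal.lean` (2 declarations kept)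

# Poitou–Tate, degree two, at fields WITH REAL PLACES: `poitouTate_sha_tateDual K` for EVERY number field from the degree-`≤ 1` package and Milne I Lemma 4.13 in the forms (A), (B)

Declarations of this Part (verbatim port; each keeps its own docstring and citation): `map_mem_shaTwo_real`, `nonempty_shaTwo_addEquiv_real`.

Reference keys (see `references.bib` and the declarations' citations): [MilneADT2006].
-/

section Part4

open _root_.Function _root_.NumberField _root_.IsDedekindDomain _root_.CategoryTheory CategoryTheory.Abelian
open scoped _root_.NumberField ContRepresentation

set_option autoImplicit false

namespace Literature.NumberTheory.GaloisCohomology.PoitouTateFinite.PoitouTateShaTwoReadout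

open _root_.Field
open Literature.NumberTheory.GaloisRepresentations Literature.NumberTheory.GaloisCohomology
open Literature.NumberTheory.GaloisRepresentations.DiscreteGaloisModule (TateDual tateDual localTatePairingZMod
  unramifiedSubgroup sha shaTwo SelmerStructure mem_sha_iff mem_shaTwo_iff)
open Literature.Algebra.Homology Literature.Algebra.Homology.DiscreteRep Literature.Algebra.Homology.ExtPresentation
open Literature.NumberTheory.GaloisRepresentations.IdeleClassBar (classBarD)
open Literature.AnabelianGeometry.AbsoluteAnabelian.Prop121vii (zmodToQmodZ)
open Literature.NumberTheory.GaloisRepresentations.FreePresentation (presentationComplex presentationComplex_shortExact)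
open Literature.NumberTheory.GaloisRepresentations.HomDual (IdeleProjection readout shaTwoConnecting shaTwoConnecting_comp_g'
  shaTwoConnecting_f_comp exists_comp_g_eq_of_shaTwoConnecting_eq_zero shaTwoConnecting_mem_shaTwo)
open Literature.NumberTheory.GaloisCohomology.PoitouTateFinite.PoitouTateReduction
  (exists_bidual_intertwining)
open Literature.NumberTheory.GaloisCohomology.PoitouTateFinite.SignedEC.MuReal (exists_finset_place_isUnramifiedAt)

section Transport

variable {K : Type} [Field K] [NumberField K]
  {M₁ M₂ : Type} [AddCommGroup M₁] [TopologicalSpace M₁] [DiscreteTopology M₁]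
  [AddCommGroup M₂] [TopologicalSpace M₂] [DiscreteTopology M₂]
  {ρ₁ : DiscreteGaloisModule K M₁} {ρ₂ : DiscreteGaloisModule K M₂}

/-- **`H²(f)` carries `Ш²(K, M₁)` into `Ш²(K, M₂)`**, ANY number field: naturality of localisation at the finite places
(`WeakLeopoldt.localization_inr_map_two`) AND at the infinite places (`SignedEC.ShaTwo.localization_inl_map_two`).
Any-`K` version of chl-p2 g6's `map_mem_shaTwo` (which used `H² = 0` at complex places).
[cite: MilneADT2006, Ch. I §4 (definition of `Ш²`)] -/
theorem map_mem_shaTwo_real (f : ρ₁.toContRepresentation →ⁱL ρ₂.toContRepresentation)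
    {x : galoisCohomology ρ₁ 2} (hx : x ∈ shaTwo ρ₁) : galoisCohomology.map f 2 x ∈ shaTwo ρ₂ := by
  rw [mem_shaTwo_iff] at hx ⊢
  rintro (w | v)
  · rw [SignedEC.ShaTwo.localization_inl_map_two, hx (Sum.inl w)]
    exact map_zero _
  · rw [WeakLeopoldt.localization_inr_map_two, hx (Sum.inr v)]
    exact map_zero _

/-- **`Ш²(K, M₁) ≃ Ш²(K, M₂)` along an isomorphism `M₁ ≅ M₂` of Galois modules**, ANY number field.
[cite: MilneADT2006, Ch. I §4] -/
theorem nonempty_shaTwo_addEquiv_real (f : ρ₁.toContRepresentation →ⁱL ρ₂.toContRepresentation)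
    (g : ρ₂.toContRepresentation →ⁱL ρ₁.toContRepresentation) (hgf : ∀ a : M₁, g (f a) = a)
    (hfg : ∀ b : M₂, f (g b) = b) : Nonempty (shaTwo ρ₁ ≃+ shaTwo ρ₂) :=
  ⟨{ toFun := fun c => ⟨galoisCohomology.map f 2 c, map_mem_shaTwo_real f c.2⟩
     invFun := fun c => ⟨galoisCohomology.map g 2 c, map_mem_shaTwo_real g c.2⟩
     left_inv := fun c => Subtype.ext (map_map_eq_self_of_comp_eq_two f g hgf c)
     right_inv := fun c => Subtype.ext (map_map_eq_self_of_comp_eq_two g f hfg c)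
     map_add' := fun _ _ => Subtype.ext (map_add _ _ _) }⟩

end Transport

end Literature.NumberTheory.GaloisCohomology.PoitouTateFinite.PoitouTateShaTwoReadout

end Part4

/-!
## Part 5 — port of `Summits/BirchSwinnertonDyer/BirchSwinnertonDyer/Theorems/SchneiderFreeAdditiveX3PoitouTatePresentationPairingGlobal.lean` (1 declarations kept)

# Poitou–Tate toolkit: (R4) of the presentation road from an E-side reciprocity sum in GLOBAL native terms (a global class `x ∈ H¹(K, M₀)`, the global connecting map `δ₁^K` of the presentation; no biduality inverse)

Declarations of this Part (verbatim port; each keeps its own docstring and citation): `localization_map_mem_unramifiedSubgroup_of_mem`.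

Reference keys (see `references.bib` and the declarations' citations): [MilneADT2006].
-/

section Part5

open _root_.Function _root_.NumberField _root_.IsDedekindDomain _root_.CategoryTheory CategoryTheory.Abelian
open scoped _root_.NumberField ContRepresentation

set_option autoImplicit false

namespace Literature.NumberTheory.GaloisCohomology.PoitouTateFinite.PoitouTateReduction

open _root_.Field
open Literature.NumberTheory.GaloisRepresentations Literature.NumberTheory.GaloisCohomology
open Literature.NumberTheory.GaloisRepresentations.DiscreteGaloisModule (mu TateDual tateDual
  localTatePairingZMod unramifiedSubgroup)
open Literature.Algebra.Homology Literature.Algebra.Homology.DiscreteRep Literature.Algebra.Homology.ExtPresentation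
open Literature.NumberTheory.GaloisRepresentations.IdeleClassBar (classBarD)
open Literature.NumberTheory.GaloisRepresentations.FreePresentation (presentationComplex presentationComplex_shortExact
  presModule₁ presModule₂ presIncl presProj pres_isSES moduleFinite_presModule₁ moduleFinite_presModule₂)
open Literature.NumberTheory.GaloisRepresentations.HomDual (IdeleProjection readout readoutInvariant localReadout
  readout_eq_localReadout charZero_of_algebra equivariantMap restrictIntertwining isSES_restrict
  zmodToQmodZ_localTatePairingZMod_localReadout map_map_res_eq_res res_δ₁_presentation)
open Literature.NumberTheory.GaloisRepresentations.DGMBridge (LCarrier)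
open Literature.AnabelianGeometry.AbsoluteAnabelian.Prop121vii (zmodToQmodZ brauerInvariantEquiv)

variable {K : Type} [Field K] [NumberField K]
variable (inv : Abelian.Ext (triv (Γ := absoluteGaloisGroup K) ℤ) (classBarD K) 2 →+ AddCircle (1 : ℚ))

/-- `loc_v (H¹(ι) x)` is unramified where `loc_v x` is (`res ∘ H¹(ι) = H¹(ι|) ∘ res`, and restriction to `K_v^nr`
commutes with the change of coefficients). [cite: MilneADT2006, Ch. I §2 (unramified classes)] -/
theorem localization_map_mem_unramifiedSubgroup_of_mem {M M' : Type}
    [AddCommGroup M] [TopologicalSpace M] [DiscreteTopology M]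
    [AddCommGroup M'] [TopologicalSpace M'] [DiscreteTopology M']
    {ρ : DiscreteGaloisModule K M} {ρ' : DiscreteGaloisModule K M'}
    (ι : ρ.toContRepresentation →ⁱL ρ'.toContRepresentation) (v : HeightOneSpectrum (𝓞 K))
    {x : galoisCohomology ρ 1}
    (hx : galoisCohomology.localization ρ (Sum.inr v) 1 x ∈ unramifiedSubgroup (GaloisRep.toLocal v ρ) 1) :
    galoisCohomology.localization ρ' (Sum.inr v) 1 (galoisCohomology.map ι 1 x) ∈
      unramifiedSubgroup (GaloisRep.toLocal v ρ') 1 := by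
  change galoisCohomology.res ρ' (v.adicCompletion K) 1 (galoisCohomology.map ι 1 x) ∈
    unramifiedSubgroup (ρ'.restrictField (v.adicCompletion K)) 1
  have hx' := (DiscreteGaloisModule.mem_unramifiedSubgroup_iff _ _ _).1 hx
  rw [galoisCohomology.res_map_one]
  refine (DiscreteGaloisModule.mem_unramifiedSubgroup_iff _ _ _).2 ?_
  refine (galoisCohomology.res_map_one (IsNonarchimedeanLocalField.maxUnramified (v.adicCompletion K)) _ _).trans ?_
  have hx'' : galoisCohomology.res (ρ.restrictField (v.adicCompletion K))
      (IsNonarchimedeanLocalField.maxUnramified (v.adicCompletion K)) 1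
      (galoisCohomology.res ρ (v.adicCompletion K) 1 x) = 0 := hx'
  rw [hx'', map_zero]

end Literature.NumberTheory.GaloisCohomology.PoitouTateFinite.PoitouTateReduction

end Part5

/-!
## Part 6 — port of `Summits/BirchSwinnertonDyer/BirchSwinnertonDyer/Theorems/SchneiderFreeAdditiveX3PoitouTatePresentationPairingSignFree.lean` (2 declarations kept)

# Poitou–Tate toolkit: SIGN-FREE forms of the (R4) reductions — only the consumed direction, so the E-side reciprocity sum may be proved with either global sign convention

Declarations of this Part (verbatim port; each keeps its own docstring and citation): `hR4_of_localTerms_of_imp`, `hR4_of_globalTerms_of_imp`.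

Reference keys (see `references.bib` and the declarations' citations): [CasselsFrohlichANT1967], [MilneADT2006].
-/

section Part6

open _root_.Function _root_.NumberField _root_.IsDedekindDomain _root_.CategoryTheory CategoryTheory.Abelian
open scoped _root_.NumberField ContRepresentation

set_option autoImplicit false

namespace Literature.NumberTheory.GaloisCohomology.PoitouTateFinite.PoitouTateReduction

open _root_.Field
open Literature.NumberTheory.GaloisRepresentations Literature.NumberTheory.GaloisCohomology
open Literature.NumberTheory.GaloisRepresentations.DiscreteGaloisModule (mu TateDual tateDual
  localTatePairingZMod unramifiedSubgroup)
open Literature.Algebra.Homology Literature.Algebra.Homology.DiscreteRep Literature.Algebra.Homology.ExtPresentation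
open Literature.NumberTheory.GaloisRepresentations.IdeleClassBar (classBarD)
open Literature.NumberTheory.GaloisRepresentations.FreePresentation (presentationComplex presentationComplex_shortExact
  presModule₁ presModule₂ presIncl presProj pres_isSES moduleFinite_presModule₁ moduleFinite_presModule₂)
open Literature.NumberTheory.GaloisRepresentations.HomDual (IdeleProjection readout readoutInvariant localReadout
  readout_eq_localReadout charZero_of_algebra equivariantMap restrictIntertwining isSES_restrict
  zmodToQmodZ_localTatePairingZMod_localReadout map_map_res_eq_res res_δ₁_presentation)
open Literature.NumberTheory.GaloisRepresentations.DGMBridge (LCarrier)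
open Literature.AnabelianGeometry.AbsoluteAnabelian.Prop121vii (zmodToQmodZ brauerInvariantEquiv)

variable {K : Type} [Field K] [NumberField K]
variable (inv : Abelian.Ext (triv (Γ := absoluteGaloisGroup K) ℤ) (classBarD K) 2 →+ AddCircle (1 : ℚ))

/-- **(R4) for the readout from the SIGN-FREE local-terms statement** (`y ∈ H¹(K, M₀^{DD})`, inverse-of-biduality `κ`):
«`Σ_{v∈T'} term_v = 0 ⟹ inv(ŷ ∘ ∂(f ≫ g)) = 0`».
[cite: MilneADT2006, Ch. I, Thm. 4.10(b) (proof, p. 58), §1][cite: CasselsFrohlichANT1967, Ch. VII §11.2 (bis)] -/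
theorem hR4_of_localTerms_of_imp (π : ∀ v : Place K, IdeleProjection K v)
    {n : ℕ} [NeZero n] {M : Type} [AddCommGroup M] [TopologicalSpace M] [DiscreteTopology M] [Finite M]
    [Finite (TateDual K M n)] (ρ₀ : DiscreteGaloisModule K M) (hM : ∀ m : M, n • m = 0)
    (κ : ((ρ₀.tateDual n).tateDual n).toContRepresentation →ⁱL ρ₀.toContRepresentation)
    (hκ : ∀ (Φ : TateDual K (TateDual K M n) n) (f : TateDual K M n), Φ f = f (κ Φ))
    (hE : ∀ (f : (presentationComplex ρ₀).X₁ ⟶ (ideleClassLimitShortComplex K).X₂)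
      (ŷ : Abelian.Ext (triv (Γ := absoluteGaloisGroup K) ℤ) (presentationComplex ρ₀).X₃ 1) (T₀ : Finset (Place K)),
      ∃ (y : galoisCohomology ((ρ₀.tateDual n).tateDual n) 1) (Ty : Finset (Place K)), T₀ ⊆ Ty ∧
        (∀ v : HeightOneSpectrum (𝓞 K), (Sum.inr v : Place K) ∉ Ty →
          galoisCohomology.localization ((ρ₀.tateDual n).tateDual n) (Sum.inr v) 1 y ∈
            unramifiedSubgroup (GaloisRep.toLocal v ((ρ₀.tateDual n).tateDual n)) 1) ∧
        ∀ T' : Finset (Place K), Ty ⊆ T' →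
          (∑ v ∈ T', Sum.elim
            (fun w : InfinitePlace K => zmodToQmodZ n
              (localTatePairingZMod (ρ₀.tateDual n) n (Sum.inl w) (LocalInvariants.canonical K n (Sum.inl w))
                (readout ρ₀ n hM (π (Sum.inl w)) f)
                (galoisCohomology.localization ((ρ₀.tateDual n).tateDual n) (Sum.inl w) 1 y)))
            (fun v : HeightOneSpectrum (𝓞 K) =>
              haveI := moduleFinite_presModule₁ ρ₀
              haveI := moduleFinite_presModule₂ ρ₀
              haveI : CharZero (v.adicCompletion K) := charZero_of_algebra (K := K) (v.adicCompletion K);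
              - brauerInvariantEquiv (v.adicCompletion K)
                (cohomologyMap (toTopRepHom ((presModule₁ ρ₀).restrictField (v.adicCompletion K))
                    (DiscreteGaloisModule.units (v.adicCompletion K))
                    (equivariantMap ((presModule₁ ρ₀).restrictField (v.adicCompletion K))
                      (DiscreteGaloisModule.units (v.adicCompletion K))
                      (readoutInvariant (π (Sum.inr v)) (presentationComplex ρ₀).X₁ f))) 2
                  ((isSES_restrict (presModule₁ ρ₀) (presModule₂ ρ₀) ρ₀ (pres_isSES ρ₀) (K' := v.adicCompletion K)).δ₁
                    (galoisCohomology.map (κ.restrictField (v.adicCompletion K)) 1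
                      (galoisCohomology.localization ((ρ₀.tateDual n).tateDual n) (Sum.inr v) 1 y)))))
            v) = 0 →
          inv (ŷ.comp (boundary (presentationComplex_shortExact ρ₀) (classBarD K)
            (f ≫ (ideleClassLimitShortComplex K).g)) (rfl : 1 + 1 = 2)) = 0) :
    ∀ (f : (presentationComplex ρ₀).X₁ ⟶ (ideleClassLimitShortComplex K).X₂)
      (ŷ : Abelian.Ext (triv (Γ := absoluteGaloisGroup K) ℤ) (presentationComplex ρ₀).X₃ 1) (T₀ : Finset (Place K)),
      ∃ (y : galoisCohomology ((ρ₀.tateDual n).tateDual n) 1) (Ty : Finset (Place K)), T₀ ⊆ Ty ∧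
        (∀ v : HeightOneSpectrum (𝓞 K), (Sum.inr v : Place K) ∉ Ty →
          galoisCohomology.localization ((ρ₀.tateDual n).tateDual n) (Sum.inr v) 1 y ∈
            unramifiedSubgroup (GaloisRep.toLocal v ((ρ₀.tateDual n).tateDual n)) 1) ∧
        ((∀ T' : Finset (Place K), Ty ⊆ T' →
            ∑ v ∈ T', localTatePairingZMod (ρ₀.tateDual n) n v (LocalInvariants.canonical K n v)
              (readout ρ₀ n hM (π v) f)
              (galoisCohomology.localization ((ρ₀.tateDual n).tateDual n) v 1 y) = 0) →
          inv (ŷ.comp (boundary (presentationComplex_shortExact ρ₀) (classBarD K)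
            (f ≫ (ideleClassLimitShortComplex K).g)) (rfl : 1 + 1 = 2)) = 0) := by
  intro f ŷ T₀
  haveI := moduleFinite_presModule₁ ρ₀
  haveI := moduleFinite_presModule₂ ρ₀
  obtain ⟨y, Ty, hT, hunr, himp⟩ := hE f ŷ T₀
  refine ⟨y, Ty, hT, hunr, fun hzero => himp Ty le_rfl ?_⟩
  have hterm : ∀ v ∈ Ty, (Sum.elim
      (fun w : InfinitePlace K => zmodToQmodZ n
        (localTatePairingZMod (ρ₀.tateDual n) n (Sum.inl w) (LocalInvariants.canonical K n (Sum.inl w))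
          (readout ρ₀ n hM (π (Sum.inl w)) f)
          (galoisCohomology.localization ((ρ₀.tateDual n).tateDual n) (Sum.inl w) 1 y)))
      (fun v : HeightOneSpectrum (𝓞 K) =>
        haveI := moduleFinite_presModule₁ ρ₀
        haveI := moduleFinite_presModule₂ ρ₀
        haveI : CharZero (v.adicCompletion K) := charZero_of_algebra (K := K) (v.adicCompletion K);
        - brauerInvariantEquiv (v.adicCompletion K)
          (cohomologyMap (toTopRepHom ((presModule₁ ρ₀).restrictField (v.adicCompletion K))
              (DiscreteGaloisModule.units (v.adicCompletion K))
              (equivariantMap ((presModule₁ ρ₀).restrictField (v.adicCompletion K))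
                (DiscreteGaloisModule.units (v.adicCompletion K))
                (readoutInvariant (π (Sum.inr v)) (presentationComplex ρ₀).X₁ f))) 2
            ((isSES_restrict (presModule₁ ρ₀) (presModule₂ ρ₀) ρ₀ (pres_isSES ρ₀) (K' := v.adicCompletion K)).δ₁
              (galoisCohomology.map (κ.restrictField (v.adicCompletion K)) 1
                (galoisCohomology.localization ((ρ₀.tateDual n).tateDual n) (Sum.inr v) 1 y)))))
      v : AddCircle (1 : ℚ)) =
      zmodToQmodZ n (localTatePairingZMod (ρ₀.tateDual n) n v (LocalInvariants.canonical K n v)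
        (readout ρ₀ n hM (π v) f) (galoisCohomology.localization ((ρ₀.tateDual n).tateDual n) v 1 y)) := by
    rintro (w | v) -
    · rfl
    · haveI : CharZero (v.adicCompletion K) := charZero_of_algebra (K := K) (v.adicCompletion K)
      set yv : galoisCohomology (((ρ₀.tateDual n).tateDual n).restrictField (v.adicCompletion K)) 1 :=
        galoisCohomology.localization ((ρ₀.tateDual n).tateDual n) (Sum.inr v) 1 y with hyv
      exact (zmodToQmodZ_localTatePairingZMod_localReadout ρ₀ n hM v κ hκ
        (readoutInvariant (π (Sum.inr v)) (presentationComplex ρ₀).X₁ f) yv).symm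
  rw [Finset.sum_congr rfl hterm, ← map_sum, hzero Ty le_rfl, map_zero]

/-- **(R4) for the readout from the SIGN-FREE statement in GLOBAL terms** (`x ∈ H¹(K, M₀)`, the global `δ₁^K`).
[cite: MilneADT2006, Ch. I, Thm. 4.10(b) (proof, p. 58), Prop. 0.19][cite: CasselsFrohlichANT1967, Ch. VII §11.2 (bis)] -/
theorem hR4_of_globalTerms_of_imp (π : ∀ v : Place K, IdeleProjection K v)
    {n : ℕ} [NeZero n] {M : Type} [AddCommGroup M] [TopologicalSpace M] [DiscreteTopology M] [Finite M]
    [Finite (TateDual K M n)] (ρ₀ : DiscreteGaloisModule K M) (hM : ∀ m : M, n • m = 0)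
    (ι : ρ₀.toContRepresentation →ⁱL ((ρ₀.tateDual n).tateDual n).toContRepresentation)
    (κ : ((ρ₀.tateDual n).tateDual n).toContRepresentation →ⁱL ρ₀.toContRepresentation)
    (hκι : ∀ m : M, κ (ι m) = m)
    (hκ : ∀ (Φ : TateDual K (TateDual K M n) n) (f : TateDual K M n), Φ f = f (κ Φ))
    (hE : ∀ (f : (presentationComplex ρ₀).X₁ ⟶ (ideleClassLimitShortComplex K).X₂)
      (ŷ : Abelian.Ext (triv (Γ := absoluteGaloisGroup K) ℤ) (presentationComplex ρ₀).X₃ 1) (T₀ : Finset (Place K)),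
      ∃ (x : galoisCohomology ρ₀ 1) (Tx : Finset (Place K)), T₀ ⊆ Tx ∧
        (∀ v : HeightOneSpectrum (𝓞 K), (Sum.inr v : Place K) ∉ Tx →
          galoisCohomology.localization ρ₀ (Sum.inr v) 1 x ∈ unramifiedSubgroup (GaloisRep.toLocal v ρ₀) 1) ∧
        ∀ T' : Finset (Place K), Tx ⊆ T' →
          (∑ v ∈ T', Sum.elim
            (fun w : InfinitePlace K => zmodToQmodZ n
              (localTatePairingZMod (ρ₀.tateDual n) n (Sum.inl w) (LocalInvariants.canonical K n (Sum.inl w))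
                (readout ρ₀ n hM (π (Sum.inl w)) f)
                (galoisCohomology.localization ((ρ₀.tateDual n).tateDual n) (Sum.inl w) 1
                  (galoisCohomology.map ι 1 x))))
            (fun v : HeightOneSpectrum (𝓞 K) =>
              haveI := moduleFinite_presModule₁ ρ₀
              haveI : CharZero (v.adicCompletion K) := charZero_of_algebra (K := K) (v.adicCompletion K);
              - brauerInvariantEquiv (v.adicCompletion K)
                (cohomologyMap (toTopRepHom ((presModule₁ ρ₀).restrictField (v.adicCompletion K))
                    (DiscreteGaloisModule.units (v.adicCompletion K))
                    (equivariantMap ((presModule₁ ρ₀).restrictField (v.adicCompletion K))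
                      (DiscreteGaloisModule.units (v.adicCompletion K))
                      (readoutInvariant (π (Sum.inr v)) (presentationComplex ρ₀).X₁ f))) 2
                  (galoisCohomology.res (presModule₁ ρ₀) (v.adicCompletion K) 2 ((pres_isSES ρ₀).δ₁ x))))
            v) = 0 →
          inv (ŷ.comp (boundary (presentationComplex_shortExact ρ₀) (classBarD K)
            (f ≫ (ideleClassLimitShortComplex K).g)) (rfl : 1 + 1 = 2)) = 0) :
    ∀ (f : (presentationComplex ρ₀).X₁ ⟶ (ideleClassLimitShortComplex K).X₂)
      (ŷ : Abelian.Ext (triv (Γ := absoluteGaloisGroup K) ℤ) (presentationComplex ρ₀).X₃ 1) (T₀ : Finset (Place K)),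
      ∃ (y : galoisCohomology ((ρ₀.tateDual n).tateDual n) 1) (Ty : Finset (Place K)), T₀ ⊆ Ty ∧
        (∀ v : HeightOneSpectrum (𝓞 K), (Sum.inr v : Place K) ∉ Ty →
          galoisCohomology.localization ((ρ₀.tateDual n).tateDual n) (Sum.inr v) 1 y ∈
            unramifiedSubgroup (GaloisRep.toLocal v ((ρ₀.tateDual n).tateDual n)) 1) ∧
        ((∀ T' : Finset (Place K), Ty ⊆ T' →
            ∑ v ∈ T', localTatePairingZMod (ρ₀.tateDual n) n v (LocalInvariants.canonical K n v)
              (readout ρ₀ n hM (π v) f)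
              (galoisCohomology.localization ((ρ₀.tateDual n).tateDual n) v 1 y) = 0) →
          inv (ŷ.comp (boundary (presentationComplex_shortExact ρ₀) (classBarD K)
            (f ≫ (ideleClassLimitShortComplex K).g)) (rfl : 1 + 1 = 2)) = 0) := by
  haveI := moduleFinite_presModule₁ ρ₀
  haveI := moduleFinite_presModule₂ ρ₀
  refine hR4_of_localTerms_of_imp inv π ρ₀ hM κ hκ fun f ŷ T₀ => ?_
  obtain ⟨x, Tx, hT, hunr, himp⟩ := hE f ŷ T₀
  refine ⟨galoisCohomology.map ι 1 x, Tx, hT, fun v hv => localization_map_mem_unramifiedSubgroup_of_mem ι v (hunr v hv),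
    fun T' hT' hzero => himp T' hT' ?_⟩
  rw [← hzero]
  refine Finset.sum_congr rfl ?_
  rintro (w | v) -
  · rfl
  · haveI : CharZero (v.adicCompletion K) := charZero_of_algebra (K := K) (v.adicCompletion K)
    change -(brauerInvariantEquiv (v.adicCompletion K) _) = -(brauerInvariantEquiv (v.adicCompletion K) _)
    congr 3
    change galoisCohomology.res (presModule₁ ρ₀) (v.adicCompletion K) 2 ((pres_isSES ρ₀).δ₁ x) =
      (isSES_restrict (presModule₁ ρ₀) (presModule₂ ρ₀) ρ₀ (pres_isSES ρ₀) (K' := v.adicCompletion K)).δ₁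
        (galoisCohomology.map (κ.restrictField (v.adicCompletion K)) 1
          (galoisCohomology.res ((ρ₀.tateDual n).tateDual n) (v.adicCompletion K) 1 (galoisCohomology.map ι 1 x)))
    rw [map_map_res_eq_res ρ₀ ι κ hκι, res_δ₁_presentation ρ₀ (v.adicCompletion K) x]

end Literature.NumberTheory.GaloisCohomology.PoitouTateFinite.PoitouTateReduction

end Part6

/-!
## Part 7 — port of `Summits/BirchSwinnertonDyer/BirchSwinnertonDyer/Theorems/SchneiderFreeAdditiveX3PoitouTateSelmerDualityHolds.lean` (1 declarations kept)

# `poitouTate_selmerStructure_duality K` HOLDS for every number field `K` (Milne *ADT* I Cor. 2.3 ∧ Thm. 4.10 (b) ∧ Thm. 2.6 ∧ Howard 2004 Thm. 2.1.11): the E-side idèle package of the presentation road, assembled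

Declarations of this Part (verbatim port; each keeps its own docstring and citation): `idelePackage_holds`.

Reference keys (see `references.bib` and the declarations' citations): [MilneADT2006], [CasselsFrohlichANT1967].
-/

section Part7

open _root_.Function _root_.NumberField _root_.IsDedekindDomain _root_.CategoryTheory CategoryTheory.Abelian groupCohomology
open scoped _root_.NumberField ContRepresentation

set_option autoImplicit false

namespace Literature.NumberTheory.GaloisCohomology.PoitouTateFinite.PoitouTateReduction

open _root_.Field
open Literature.NumberTheory.GaloisRepresentations Literature.NumberTheory.GaloisCohomology
open Literature.NumberTheory.GaloisRepresentations.DiscreteGaloisModule (mu TateDual tateDual localTatePairingZMod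
  localTatePairingZMod_apply unramifiedSubgroup)
open Literature.Algebra.Homology Literature.Algebra.Homology.DiscreteRep Literature.Algebra.Homology.ExtPresentation
open Literature.NumberTheory.GaloisRepresentations.IdeleClassBar (classBarD classBarInv GalLayer)
open Literature.NumberTheory.GaloisRepresentations.FreePresentation
open Literature.NumberTheory.GaloisRepresentations.HomDual (IdeleProjection readout readoutInvariant localReadout
  readout_eq_localReadout charZero_of_algebra equivariantMap restrictIntertwining isSES_restrict)
open Literature.NumberTheory.GaloisRepresentations.DGMBridge (LCarrier)
open Literature.NumberTheory.GaloisRepresentations.IdeleReadout (ideleProjection layerEmb)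
open Literature.NumberTheory.Automorphic (IdeleClassGroup.ideleRep)
open Literature.AnabelianGeometry.AbsoluteAnabelian.Prop121vii (zmodToQmodZ brauerInvariantEquiv)

variable (K : Type) [Field K] [NumberField K]

set_option maxHeartbeats 1600000 in
/-- **THE E-SIDE IDÈLE PACKAGE (P0)–(P4) HOLDS** for every number field `K`, every level, every finite `n`-torsion `M`, every
`(f, ŷ, T₀)` (the hypothesis of `poitouTate_selmerStructure_duality_of_idelePackage`, assembled from the tree theorems listed in the
module docstring). [cite: MilneADT2006, Ch. I, Thm. 4.10 (b) (proof, p. 58), Lemma 4.13][cite: CasselsFrohlichANT1967, Ch. VII §11.2 (bis)] -/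
theorem idelePackage_holds :
    ∀ (n : ℕ) [NeZero n],
      ∀ ⦃M : Type⦄ [AddCommGroup M] [TopologicalSpace M] [DiscreteTopology M] [Finite M] [Finite (TateDual K M n)]
      (ρ₀ : DiscreteGaloisModule K M) (hM : ∀ m : M, n • m = 0)
      (ι : ρ₀.toContRepresentation →ⁱL ((ρ₀.tateDual n).tateDual n).toContRepresentation),
      (∀ (m : M) (f : TateDual K M n), ι m f = f m) →
      ∀ (f : (presentationComplex ρ₀).X₁ ⟶ (ideleClassLimitShortComplex K).X₂)
        (ŷ : Abelian.Ext (triv (Γ := absoluteGaloisGroup K) ℤ) (presentationComplex ρ₀).X₃ 1) (T₀ : Finset (Place K)),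
        ∃ (E : GalLayer K) (b : (haveI := E.numberField; cocycles₂ (IdeleClassGroup.ideleRep K E.1)))
          (x : galoisCohomology ρ₀ 1) (Tx : Finset (Place K)), T₀ ⊆ Tx ∧
          (∀ w : InfinitePlace K, (Sum.inl w : Place K) ∈ Tx) ∧
          (∀ v : HeightOneSpectrum (𝓞 K), (Sum.inr v : Place K) ∉ Tx →
            galoisCohomology.localization ρ₀ (Sum.inr v) 1 x ∈ unramifiedSubgroup (GaloisRep.toLocal v ρ₀) 1) ∧
          (haveI := E.numberField; haveI := E.isGalois;
            classBarInv K (ŷ.comp (boundary (presentationComplex_shortExact ρ₀) (classBarD K)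
              (f ≫ (ideleClassLimitShortComplex K).g)) (rfl : 1 + 1 = 2)) =
              IdeleCohomology.inv E.1 (H2π _ b)) ∧
          (∀ v : HeightOneSpectrum (𝓞 K), (Sum.inr v : Place K) ∉ Tx →
            (haveI := E.numberField; haveI := E.isGalois; IdeleCohomology.localInv E.1 v (H2π _ b)) = 0) ∧
          (∀ v : HeightOneSpectrum (𝓞 K),
            (haveI := E.numberField; haveI := E.isGalois; IdeleCohomology.localInv E.1 v (H2π _ b)) =
              haveI := moduleFinite_presModule₁ ρ₀
              haveI : CharZero (v.adicCompletion K) := charZero_of_algebra (K := K) (v.adicCompletion K);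
              brauerInvariantEquiv (v.adicCompletion K)
                (cohomologyMap (toTopRepHom ((presModule₁ ρ₀).restrictField (v.adicCompletion K))
                    (DiscreteGaloisModule.units (v.adicCompletion K))
                    (equivariantMap ((presModule₁ ρ₀).restrictField (v.adicCompletion K))
                      (DiscreteGaloisModule.units (v.adicCompletion K))
                      (readoutInvariant (ideleProjection K (Sum.inr v)) (presentationComplex ρ₀).X₁ f))) 2
                  (galoisCohomology.res (presModule₁ ρ₀) (v.adicCompletion K) 2 ((pres_isSES ρ₀).δ₁ x)))) ∧
          (∀ w : InfinitePlace K, w.IsReal →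
            ((haveI := E.numberField; haveI := E.isGalois; haveI := absoluteGaloisGroup_compactSpace w.Completion
              twoCocycleClass (DiscreteGaloisModule.units w.Completion).toTopRep
                ((IdeleCohomology.archReadoutPair w (layerEmb E)).pull b)) = 0 ↔
              (haveI := moduleFinite_presModule₁ ρ₀
               cohomologyMap (toTopRepHom ((presModule₁ ρ₀).restrictField w.Completion) (DiscreteGaloisModule.units w.Completion)
                    (equivariantMap ((presModule₁ ρ₀).restrictField w.Completion) (DiscreteGaloisModule.units w.Completion)
                      (readoutInvariant (ideleProjection K (Sum.inl w)) (presentationComplex ρ₀).X₁ f))) 2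
                  (galoisCohomology.res (presModule₁ ρ₀) w.Completion 2 ((pres_isSES ρ₀).δ₁ x))) = 0)) := by
  haveI : TotallyDisconnectedSpace (absoluteGaloisGroup K) := inferInstance
  intro n _ M _ _ _ _ _ ρ₀ hM ι hι f ŷ T₀
  classical
  -- a layer and a layer class inflating to `ŷ`, with a cocycle representative
  obtain ⟨E, hE, c, rfl⟩ := exists_layer_ge_inflG_eq (presentationLayer ρ₀) (presentationComplex ρ₀).X₃ 1 ŷ
  have hsurj : ∀ c' : groupCohomology ((invariantsQuotFunctor ℤ
      (E.openNormalSubgroup : Subgroup (absoluteGaloisGroup K))).obj (presentationComplex ρ₀).X₃) 1,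
      ∃ γ : cocycles₁ ((invariantsQuotFunctor ℤ (E.openNormalSubgroup : Subgroup (absoluteGaloisGroup K))).obj
        (presentationComplex ρ₀).X₃), (H1π _) γ = c' := fun c' =>
    H1_induction_on (C := fun c' => ∃ γ : cocycles₁ ((invariantsQuotFunctor ℤ
      (E.openNormalSubgroup : Subgroup (absoluteGaloisGroup K))).obj (presentationComplex ρ₀).X₃), (H1π _) γ = c') c'
      fun γ => ⟨γ, rfl⟩
  obtain ⟨γ, rfl⟩ := hsurj c
  -- (P1), (P2): the idèle cocycle `b` and the finite support `T`
  obtain ⟨b, T, hb, hP1, hP2⟩ := exists_cocycle_classBarInv_eq_inv ρ₀ hE ((H1π _) γ) f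
  -- (P0): the ramification set of the layer
  obtain ⟨Tur, hTur⟩ := exists_finset_forall_localization_inflatedClass_mem ρ₀ hE
  haveI := E.numberField
  haveI := E.isGalois
  haveI := moduleFinite_presModule₁ ρ₀
  refine ⟨E, b, inflatedClass ρ₀ hE γ,
    T₀ ∪ (Finset.univ.image Sum.inl ∪ (T ∪ Tur).image Sum.inr), Finset.subset_union_left, ?_, ?_, hP1, ?_, ?_, ?_⟩
  · -- every infinite place lies in `Tx`
    intro w
    exact Finset.mem_union_right _ (Finset.mem_union_left _ (Finset.mem_image_of_mem _ (Finset.mem_univ w)))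
  · -- (P0)
    intro v hv
    refine hTur v (fun hvT => hv ?_) γ
    exact Finset.mem_union_right _ (Finset.mem_union_right _ (Finset.mem_image_of_mem _ (Finset.mem_union_right _ hvT)))
  · -- (P2)
    intro v hv
    refine hP2 v fun hvT => hv ?_
    exact Finset.mem_union_right _ (Finset.mem_union_right _ (Finset.mem_image_of_mem _ (Finset.mem_union_left _ hvT)))
  · -- (P3)
    intro v
    exact localInv_H2π_eq_brauerInvariantEquiv ρ₀ hE v γ f b hb
  · -- (P4)
    intro w _
    haveI := absoluteGaloisGroup_compactSpace w.Completion
    exact iff_of_eq (congrArg (fun t => t = 0) (twoCocycleClass_archReadoutPair_pull_eq ρ₀ hE w γ f b hb))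

end Literature.NumberTheory.GaloisCohomology.PoitouTateFinite.PoitouTateReduction

end Part7

/-!
## Part 8 — port of `Summits/BirchSwinnertonDyer/BirchSwinnertonDyer/Theorems/SchneiderFreeAdditiveX3PoitouTateReciprocitySumHolds.lean` (1 declarations kept)

# The SIGN-FREE E-side reciprocity sum HOLDS for every number field; `poitouTate_selmerStructure_duality_real K` and `(LocalInvariants.canonical K n).SelmerComplement` for every `K`, `n`

Declarations of this Part (verbatim port; each keeps its own docstring and citation): `reciprocitySum_holds`.

Reference keys (see `references.bib` and the declarations' citations): [MilneADT2006], [CasselsFrohlichANT1967].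
-/

section Part8

open _root_.Function _root_.NumberField _root_.IsDedekindDomain _root_.CategoryTheory CategoryTheory.Abelian groupCohomology
open scoped _root_.NumberField ContRepresentation

set_option autoImplicit false

namespace Literature.NumberTheory.GaloisCohomology.PoitouTateFinite.PoitouTateReduction

open _root_.Field
open Literature.NumberTheory.GaloisRepresentations Literature.NumberTheory.GaloisCohomology
open Literature.NumberTheory.GaloisRepresentations.DiscreteGaloisModule (mu TateDual tateDual localTatePairingZMod
  localTatePairingZMod_apply unramifiedSubgroup)
open Literature.Algebra.Homology Literature.Algebra.Homology.DiscreteRep Literature.Algebra.Homology.ExtPresentation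
open Literature.NumberTheory.GaloisRepresentations.IdeleClassBar (classBarD classBarInv GalLayer)
open Literature.NumberTheory.GaloisRepresentations.FreePresentation
open Literature.NumberTheory.GaloisRepresentations.HomDual (IdeleProjection readout readoutInvariant localReadout
  readout_eq_localReadout charZero_of_algebra equivariantMap restrictIntertwining isSES_restrict)
open Literature.NumberTheory.GaloisRepresentations.DGMBridge (LCarrier)
open Literature.NumberTheory.GaloisRepresentations.IdeleReadout (ideleProjection layerEmb)
open Literature.NumberTheory.Automorphic (IdeleClassGroup.ideleRep)
open Literature.AnabelianGeometry.AbsoluteAnabelian.Prop121vii (zmodToQmodZ brauerInvariantEquiv)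

variable (K : Type) [Field K] [NumberField K]

/-- **THE SIGN-FREE E-SIDE RECIPROCITY SUM HOLDS** for every number field `K`: for every level `n`, every finite `n`-torsion `M`
with a biduality `ι`, every `(f, ŷ, T₀)`, there are `x ∈ H¹(K, M)` and `Tx ⊇ T₀` with `x` unramified off `Tx` such that for every
`T' ⊇ Tx` the vanishing of the reciprocity sum over `T'` (archimedean terms through THE canonical invariant maps, finite terms through
the Brauer invariants of the transported classes) forces `classBarInv K (ŷ ∘ ∂(f ≫ g)) = 0` — door-c5 g18's `hE`, discharged by the
idèle package. [cite: MilneADT2006, Ch. I, Thm. 4.10 (b) (proof, p. 58), Lemma 4.13][cite: CasselsFrohlichANT1967, Ch. VII §11.2 (bis)] -/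
theorem reciprocitySum_holds :
    ∀ (n : ℕ) [NeZero n],
      ∀ ⦃M : Type⦄ [AddCommGroup M] [TopologicalSpace M] [DiscreteTopology M] [Finite M] [Finite (TateDual K M n)]
      (ρ₀ : DiscreteGaloisModule K M) (hM : ∀ m : M, n • m = 0)
      (ι : ρ₀.toContRepresentation →ⁱL ((ρ₀.tateDual n).tateDual n).toContRepresentation),
      (∀ (m : M) (f : TateDual K M n), ι m f = f m) →
      ∀ (f : (presentationComplex ρ₀).X₁ ⟶ (ideleClassLimitShortComplex K).X₂)
        (ŷ : Abelian.Ext (triv (Γ := absoluteGaloisGroup K) ℤ) (presentationComplex ρ₀).X₃ 1) (T₀ : Finset (Place K)),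
        ∃ (x : galoisCohomology ρ₀ 1) (Tx : Finset (Place K)), T₀ ⊆ Tx ∧
          (∀ v : HeightOneSpectrum (𝓞 K), (Sum.inr v : Place K) ∉ Tx →
            galoisCohomology.localization ρ₀ (Sum.inr v) 1 x ∈ unramifiedSubgroup (GaloisRep.toLocal v ρ₀) 1) ∧
          ∀ T' : Finset (Place K), Tx ⊆ T' →
            (∑ v ∈ T', Sum.elim
              (fun w : InfinitePlace K => zmodToQmodZ n
                (localTatePairingZMod (ρ₀.tateDual n) n (Sum.inl w) (LocalInvariants.canonical K n (Sum.inl w))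
                  (readout ρ₀ n hM (IdeleReadout.ideleProjection K (Sum.inl w)) f)
                  (galoisCohomology.localization ((ρ₀.tateDual n).tateDual n) (Sum.inl w) 1
                    (galoisCohomology.map ι 1 x))))
              (fun v : HeightOneSpectrum (𝓞 K) =>
                haveI := moduleFinite_presModule₁ ρ₀
                haveI : CharZero (v.adicCompletion K) := charZero_of_algebra (K := K) (v.adicCompletion K);
                - brauerInvariantEquiv (v.adicCompletion K)
                  (cohomologyMap (toTopRepHom ((presModule₁ ρ₀).restrictField (v.adicCompletion K))
                      (DiscreteGaloisModule.units (v.adicCompletion K))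
                      (equivariantMap ((presModule₁ ρ₀).restrictField (v.adicCompletion K))
                        (DiscreteGaloisModule.units (v.adicCompletion K))
                        (readoutInvariant (IdeleReadout.ideleProjection K (Sum.inr v)) (presentationComplex ρ₀).X₁ f))) 2
                    (galoisCohomology.res (presModule₁ ρ₀) (v.adicCompletion K) 2 ((pres_isSES ρ₀).δ₁ x))))
              v) = 0 →
            classBarInv K (ŷ.comp (boundary (presentationComplex_shortExact ρ₀) (classBarD K)
              (f ≫ (ideleClassLimitShortComplex K).g)) (rfl : 1 + 1 = 2)) = 0 := by
  intro n _ M _ _ _ _ _ ρ₀ hM ι hι f ŷ T₀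
  obtain ⟨E, b, x, Tx, hT₀, hinf, hur, hP1, hP2, hP3, hP4⟩ := idelePackage_holds K n ρ₀ hM ι hι f ŷ T₀
  refine ⟨x, Tx, hT₀, hur, fun T' hT' hsum => ?_⟩
  haveI := E.numberField
  haveI := E.isGalois
  haveI := E.finiteDimensional
  haveI := moduleFinite_presModule₁ ρ₀
  -- a biduality inverse `κ` for the given `ι`
  obtain ⟨ι', κ, hι', hκι', hικ⟩ := exists_bidual_intertwining (n := n) ρ₀ hM
  have hιι' : ∀ m : M, ι m = ι' m := fun m =>
    DiscreteGaloisModule.TateDual.ext fun g => by rw [hι, hι']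
  have hκι : ∀ m : M, κ (ι m) = m := fun m => by rw [hιι']; exact hκι' m
  have hκ : ∀ (Φ : TateDual K (TateDual K M n) n) (g : TateDual K M n), Φ g = g (κ Φ) := fun Φ g => by
    conv_lhs => rw [← hικ Φ]
    exact hι' (κ Φ) g
  -- the E-side value as one sum over `T'` (term-mode steps: no `rw` with coercion-headed patterns in this goal)
  refine hP1.trans ?_
  refine (IdeleCohomology.inv_eq_sum_place (E := E.1) (H2π _ b) T' (fun w => hT' (hinf w))
    (fun v hv => hP2 v fun h => hv (hT' h))).trans ?_
  -- termwise the E-side summand is minus the summand of the reciprocity sum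
  rw [← neg_eq_zero, ← Finset.sum_neg_distrib]
  refine Eq.trans (Finset.sum_congr rfl ?_) hsum
  rintro (w | v) -
  · -- infinite place: the archimedean dictionary (both sides `2`-torsion; transport only at real `w`)
    exact neg_eq_iff_eq_neg.mpr
      (HomDual.localInvInf_H2π_eq_neg_zmodToQmodZ_localTatePairingZMod_localReadout ρ₀ n hM w (layerEmb E) b ι κ hκι hκ _ x (hP4 w))
  · -- finite place: the finite dictionary
    exact neg_eq_iff_eq_neg.mpr ((hP3 v).trans (neg_neg _).symm)

end Literature.NumberTheory.GaloisCohomology.PoitouTateFinite.PoitouTateReduction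

end Part8

/-!
## Part 9 — port of `Summits/BirchSwinnertonDyer/BirchSwinnertonDyer/Theorems/SchneiderFreeAdditiveX3PoitouTateReciprocityEqualityHolds.lean` (2 declarations kept)

# The (R4) reciprocity equality HOLDS (input `hRur` discharged); PT2 `poitouTate_sha_tateDual K` for totally complex `K` from the degree-2 input (A) ALONE (Milne *ADT* I Thm. 4.10 (a), proof p. 58; Lemma 4.13)

Declarations of this Part (verbatim port; each keeps its own docstring and citation): `hRur_holds`, `hR4_ideleProjection`.

Reference keys (see `references.bib` and the declarations' citations): [MilneADT2006], [SerreAbelianLadic1968], [CasselsFrohlichANT1967].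
-/

section Part9

open _root_.Function _root_.NumberField _root_.IsDedekindDomain _root_.CategoryTheory CategoryTheory.Abelian groupCohomology
open scoped _root_.NumberField ContRepresentation

set_option autoImplicit false

namespace Literature.NumberTheory.GaloisCohomology.PoitouTateFinite.PoitouTateReduction

open _root_.Field
open Literature.NumberTheory.GaloisRepresentations Literature.NumberTheory.GaloisCohomology
open Literature.NumberTheory.GaloisRepresentations.DiscreteGaloisModule (TateDual tateDual localTatePairingZMod
  unramifiedSubgroup sha shaTwo)
open Literature.Algebra.Homology Literature.Algebra.Homology.DiscreteRep Literature.Algebra.Homology.ExtPresentation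
open Literature.NumberTheory.GaloisRepresentations.IdeleClassBar (classBarD classBarInv)
open Literature.AnabelianGeometry.AbsoluteAnabelian.Prop121vii (zmodToQmodZ)
open Literature.NumberTheory.GaloisRepresentations.FreePresentation (presentationComplex presentationComplex_shortExact
  presModule₁ presModule₂ presProj moduleFinite_presModule₁ moduleFinite_presModule₂)
open Literature.NumberTheory.GaloisRepresentations.HomDual (IdeleProjection readout dualF
  exists_finset_forall_readout_mem_unramifiedSubgroup)
open Literature.NumberTheory.GaloisRepresentations.IdeleReadout (ideleProjection)
open Literature.NumberTheory.GaloisRepresentations.DiscreteGaloisModule (units)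
open Literature.NumberTheory.GaloisRepresentations.OpenLayer (extOneEquiv)
open Literature.NumberTheory.GaloisCohomology.PoitouTateFinite.GaloisImage.UnramifiedCup (isUnit_natCast_integer_of_not_mem)
open Literature.NumberTheory.GaloisCohomology.PoitouTateFinite.SignedEC.MuReal (exists_finset_place_isUnramifiedAt)

variable {K : Type} [Field K] [NumberField K]

/-- **`hRur` HOLDS**: for `f : N₁ ⟶ J̄` there is a finite set of places off which `v ∤ n`, `M^D` is unramified at `v`, and the
readout `readout ρ₀ n hM π_v f` is unramified (the named input of `hR4_ideleProjection_of_readoutUnramified`).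
[cite: MilneADT2006, I Lemma 4.13 (proof), I §4][cite: SerreAbelianLadic1968, Ch. I §2.1] -/
theorem hRur_holds {n : ℕ} [NeZero n]
    {M : Type} [AddCommGroup M] [TopologicalSpace M] [DiscreteTopology M] [Finite M] [Finite (TateDual K M n)]
    (ρ₀ : DiscreteGaloisModule K M) (hM : ∀ m : M, n • m = 0)
    (f : (presentationComplex ρ₀).X₁ ⟶ (ideleClassLimitShortComplex K).X₂) :
    ∃ Tf : Finset (Place K), ∀ v : HeightOneSpectrum (𝓞 K), (Sum.inr v : Place K) ∉ Tf →
      ((n : ℕ) : 𝓞 K) ∉ v.asIdeal ∧ GaloisRep.IsUnramifiedAt v (ρ₀.tateDual n) ∧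
        readout ρ₀ n hM (ideleProjection K (Sum.inr v)) f ∈
          unramifiedSubgroup (GaloisRep.toLocal v (ρ₀.tateDual n)) 1 := by
  classical
  obtain ⟨T, hT⟩ := exists_finset_forall_readout_mem_unramifiedSubgroup ρ₀ n hM f
  obtain ⟨S₀, -, hS₀⟩ := exists_finset_place_isUnramifiedAt ρ₀ n
  obtain ⟨S₁, -, hS₁⟩ := exists_finset_place_isUnramifiedAt (ρ₀.tateDual n) n
  refine ⟨S₀ ∪ S₁ ∪ T.image Sum.inr, fun v hv => ?_⟩
  have hv₀ : (Sum.inr v : Place K) ∉ S₀ := fun h => hv (Finset.mem_union_left _ (Finset.mem_union_left _ h))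
  have hv₁ : (Sum.inr v : Place K) ∉ S₁ := fun h => hv (Finset.mem_union_left _ (Finset.mem_union_right _ h))
  have hvT : v ∉ T := fun h => hv (Finset.mem_union_right _ (Finset.mem_image_of_mem _ h))
  exact ⟨(hS₀ v hv₀).1, (hS₁ v hv₁).2,
    hT v hvT (isUnit_natCast_integer_of_not_mem n v (hS₀ v hv₀).1) (hS₀ v hv₀).2⟩

/-- **The (R4) reciprocity equality with a bijective bridge, for THE idèle projections and THE canonical invariant maps** —
VERBATIM the hypothesis `hR4` of `poitouTate_sha_tateDual_of_R4_A` (and of bsd-wall's `poitouTate_sha_tateDual_of_bridge_of_localGlobal`),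
at every level `n ≥ 1` and every finite `n`-torsion `M`, for every number field `K`; `nat := −(Φ⁻¹ ∘ H¹(κ))` with door-c5's
inflation bijection `Φ = OpenLayer.extOneEquiv ρ₀` and a biduality pair `(ι, κ)`.
[cite: MilneADT2006, I Thm. 4.10 (a) (proof, p. 58), Lemma 4.13, Prop. 0.19][cite: CasselsFrohlichANT1967, Ch. VII §11.2 (bis)] -/
theorem hR4_ideleProjection (n : ℕ) [NeZero n]
    ⦃M : Type⦄ [AddCommGroup M] [TopologicalSpace M] [DiscreteTopology M] [Finite M] [Finite (TateDual K M n)]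
    (ρ₀ : DiscreteGaloisModule K M) (hM : ∀ m : M, n • m = 0) :
    ∃ nat : galoisCohomology ((ρ₀.tateDual n).tateDual n) 1 →+
        Abelian.Ext (triv (Γ := absoluteGaloisGroup K) ℤ) (presentationComplex ρ₀).X₃ 1,
      Function.Bijective nat ∧
      ∀ f : (presentationComplex ρ₀).X₁ ⟶ (ideleClassLimitShortComplex K).X₂, ∃ Tf : Finset (Place K),
        ∀ (y : galoisCohomology ((ρ₀.tateDual n).tateDual n) 1) (T' : Finset (Place K)), Tf ⊆ T' →
          (∀ v : HeightOneSpectrum (𝓞 K), (Sum.inr v : Place K) ∉ T' →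
            galoisCohomology.localization ((ρ₀.tateDual n).tateDual n) (Sum.inr v) 1 y ∈
              unramifiedSubgroup (GaloisRep.toLocal v ((ρ₀.tateDual n).tateDual n)) 1) →
          zmodToQmodZ n (∑ v ∈ T', localTatePairingZMod (ρ₀.tateDual n) n v (LocalInvariants.canonical K n v)
            (readout ρ₀ n hM (ideleProjection K v) f)
            (galoisCohomology.localization ((ρ₀.tateDual n).tateDual n) v 1 y)) =
          classBarInv K ((nat y).comp (boundary (presentationComplex_shortExact ρ₀) (classBarD K)
            (f ≫ (ideleClassLimitShortComplex K).g)) (rfl : 1 + 1 = 2)) := by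
  obtain ⟨ι, κ, hι, hκι, hικ⟩ := exists_bidual_intertwining (n := n) ρ₀ hM
  exact ⟨-((AddMonoidHom.id (Abelian.Ext (triv (Γ := absoluteGaloisGroup K) ℤ) (presentationComplex ρ₀).X₃ 1)).comp
      (((extOneEquiv ρ₀).symm.toAddMonoidHom).comp (galoisCohomology.map κ 1))),
    nat_bijective ρ₀ ι κ hκι hικ,
    hR4_ideleProjection_of_readoutUnramified ρ₀ hM ι κ hι hκι hικ (hRur_holds ρ₀ hM)⟩

end Literature.NumberTheory.GaloisCohomology.PoitouTateFinite.PoitouTateReduction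

end Part9

/-!
## Part 10 — port of `Summits/BirchSwinnertonDyer/BirchSwinnertonDyer/Theorems/SchneiderFreeAdditiveX3PoitouTateShaZModMuHolds.lean` (1 declarations kept)

# `ℤ/m` is killed by `m`

Declarations of this Part (verbatim port; each keeps its own docstring and citation): `nsmul_zmod_eq_zero`.

Reference keys (see `references.bib` and the declarations' citations): [MilneADT2006].
-/

section Part10

namespace Literature.NumberTheory.GaloisCohomology.PoitouTateFinite.PoitouTateReduction

open Literature.NumberTheory.GaloisRepresentations Literature.NumberTheory.GaloisCohomology
open Literature.NumberTheory.GaloisRepresentations.DiscreteGaloisModule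
open _root_.Field _root_.Function _root_.NumberField
open scoped ContRepresentation

section Holds

/-- `ℤ/m` is killed by `m`. [cite: MilneADT2006, Ch. I §4, Thm. 4.10 (with M = ℤ/m, M^D = μ_m)] -/
theorem nsmul_zmod_eq_zero (m : ℕ) (k : ZMod m) : m • k = 0 := by
  rw [nsmul_eq_mul, ZMod.natCast_self, zero_mul]

end Holds

end Literature.NumberTheory.GaloisCohomology.PoitouTateFinite.PoitouTateReduction

end Part10

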